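/-
Copyright: lit-balaban Phase-2 proof seat p34 (gen 18).  Statement-level skeleton of a published paper; no proof claims beyond what the
kernel checks below.
-/
import Literature.MathematicalPhysics.QuantumFieldTheory.BalabanImbrieJaffe1984to88.BIJ88FreeNeumannLaplacianRegion
import Literature.MathematicalPhysics.QuantumFieldTheory.BalabanImbrieJaffe1984to88.BIJ88BlockUnionNash

/-!
# [Balaban1983RegularityDecay] (1.10) p. 573 / [BalabanImbrieJaffe1988] (2.30) p. 263 — **THE FREE INPUT OF THE RANDOM-WALK EXPANSION ON A
# GENERAL `k`-BLOCK UNION: the exponentially TILTED COLUMN of the free Neumann region resolvent `R_Ω = (L^{2k}(−Δ^N_Ω) + 1)⁻¹` is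
# square-summable `k`-UNIFORMLY, `Σ_y (e^{ψ(y)−ψ(x)}R_Ω(y,x))² ≤ K(D,L)/L^{kD}`, for EVERY union `Ω` of `k`-blocks of the fine torus, every
# `x ∈ Ω` and every admissible weight `ψ` (bond-Lipschitz `t/L^k` on `Ω*`, flat across the bonds leaving `Ω`, second-order drift), `D ≤ 3`**
# — engine file 3b behind the `k`-uniform SUP-NORM (operator-form) decay of the REGION Neumann propagators (file 4), by a discrete
# NASH–DAVIES ITERATION of the reflecting walk `P = 1 − (8D)⁻¹(−Δ^N_Ω)` and the Neumann series `R_Ω = α⁻¹Σ_m (qP)^m`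

T. Bałaban, *Regularity and decay of lattice Green's functions*, Commun. Math. Phys. **89** (1983) 571–597 [Balaban1983RegularityDecay] ([6] of
[BalabanImbrieJaffe1988]), (1.3)/(1.6) p. 572, (2.12)–(2.13) p. 577 (the random walk representation), (1.10) p. 573, (2.44) p. 584; T. Bałaban, J. Imbrie, A. Jaffe, *Effective
action and cluster properties of the abelian Higgs model*, Commun. Math. Phys. **114** (1988) 257–315 [BalabanImbrieJaffe1988], (2.27)/(2.30)
p. 263 [PDF 7]; [I] = T. Bałaban, J. Imbrie, A. Jaffe, *Renormalization of the Higgs model: minimizers, propagators and the stability of mean field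
theory*, Commun. Math. Phys. **97** (1985) 299–329 [BalabanImbrieJaffe1985], §7.3 p. 326, (5.1.2)–(5.1.3) p. 313.

statement-level skeleton of published theorems with citation tags; proofs where landed; nothing here is a claim about the Yang–Mills mass gap

PDF held: `paper:balaban1988-cmp114-bij-abelian-higgs-effective-action` (journal page = PDF page + 256), p. 262–263 [PDF 6–7];
`paper:balaban1985-cmp97-bij-higgs-minimizers` (journal page = PDF page + 298), p. 326 [PDF 28].

CITATION HEADER (lean-in-tree rule).  Part of the lit-balaban TYPED SKELETON (HOME `run/shared/lean/pub/lit-balaban/`), PHASE-2 proof seat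
p34 gen 18 (unit `lit-balaban-p34-g18`; TAKING line HOME/STATUS.md 2026-08-23T04:22:50Z; free-target protocol G.5-34(d) — source: the
owner's `HOME/lit-balaban-r18/C2S14-CLOSURE.md` v1.16s «REMAINING NON-FLAT FRONT (α′) operator-form (H1.10) for general regions at small u»).
WHAT IS REPRODUCED: nothing printed is restated — ENGINE file behind a located member of rows **C2.Eq2.30** (owner r18) and **C1.Eq7.3.1-7.3.2**
(owner r15): the free input of [6] (1.10) (*"|(G_k(Ω, A)f)(x)| ≤ c₀exp(−δ₀ dist(x, supp f))‖f‖_∞"*) in the squared-column form consumed by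
the Cauchy–Schwarz assembly of file 4 (as p27's `BIJ88FreeNeumannResolventBox.tilted_row_boxR_sq_le` is consumed by
`BIJ88NeumannPropagatorSmallFieldSupDecay.decay110_smallField_cube`), now for an ARBITRARY `k`-block union instead of a cube.
USED BY NAME: p34's `BIJ88FreeNeumannLaplacianRegion` (`lapN`, `walk_apply_nonneg`, `sum_walk_apply'`, `walk_apply_of_not_mem`, `davies_step`,
`ell1_step_le`, `inv_mul_massOp`, `inv_massOp_apply_nonneg`, `sum_inv_massOp_apply`) and `BIJ88BlockUnionNash.nash_blockUnion`; r18's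
`starB`; p31's `IsBlockUnion`.  Kind: theorems only (no definition, no `Prop`-valued fact).

THE MECHANISM (DIVERGENCE OF METHOD from [6], disclosed).  [6] proves (1.10) by a multiscale random-walk expansion whose free building blocks
are box Green's functions ([6] §2–§3; the lineage's `B3Ineq210ZeroBox`); these have no analogue for a general block union.  Here the free
region resolvent is expanded in the Neumann series of the REFLECTING WALK, `R_Ω = (n²(−Δ^N_Ω) + 1)⁻¹ = α⁻¹Σ_{m<N}(qP)^m + R_Ω(qP)^N`
(`n = L^k`, `α = 8Dn² + 1`, `q = 8Dn²/α`), and the tilted walk `g_m(y) = e^{ψ(y)−ψ(x)}P^m(y,x)` is controlled by a discrete Nash–Davies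
iteration: the `ℓ¹` mass grows at most like `Λ^m`, `Λ = 1 + (8D)⁻¹κ` (p34 `ell1_step_le`, flatness of `ψ` across the bonds leaving `Ω`); the
`ℓ²` mass satisfies `u_{m+1} ≤ (1+τ²)u_m − (8D)⁻¹E_Ω(g_m)` (p34 `davies_step`) and the Dirichlet form is bounded below at every scale
`j ≤ k` by the block-union Nash inequality (p34 `nash_blockUnion`); normalising by `Θ^m`, `Θ = (1+τ²)Λ²`, gives
`ũ_{m+1} ≤ ũ_m − (16DL^{2j})⁻¹(ũ_m − L^{−jD})⁺` for all `j ≤ k`, whence the `L`-ADIC DESCENT `ũ_m ≤ 2L^{−jD}` for `m ≥ 64DL^DL^{2j}`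
(Bernoulli), and Minkowski in `ℓ²` sums the series: `‖e^{ψ−ψ(x)}R_Ω(·,x)‖₂ ≤ α⁻¹Σ_m q^mΘ^{m/2}√ũ_m + (remainder → 0)`, with
`q²Θ ≤ (1 − (2α)⁻¹)²` for `t ≤ 1/(100D)`; the scale sums are geometric with ratio `√(L^{4−D}) > 1` (`D ≤ 3`).  Constants: `K = K₂²`,
`K₂ = K₁/(8D) + 2√2`, `K₁ = W(1 + √2L²/(√(L^{4−D}) − 1))`, `W = 64DL^D` — functions of `(D, L)` only, valid at EVERY `x ∈ Ω` (no
depth restriction).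

WHAT IS PROVED (0 `sorry`; standard axioms; theorems only).
* §1–§2 (private real-variable lemmas) Bernoulli `one_sub_pow_mul_le`, the descent stage `stage_le`, **the `L`-adic descent lemma `descent`**,
  the pointwise scale bound `sqrt_le_scaleSum`, the weighted scale sum `sum_geom_sqrt_le`, the scale bookkeeping `scaleSum_le`
  (`scale_identity`), Minkowski `sqrt_sum_sq_add_le` / `sqrt_sum_sq_sum_le` / `sqrt_sum_sq_mul` / `sqrt_sum_sq_le_of_abs_le`,
  `le_init_of_step`, **the normalised Nash–Davies step `normalized_step`**, the smallness `theta_le` of `Θ − 1`, `geom_sqrt_le`.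
* §3 powers of the reflecting walk: `walkPow_apply_nonneg`, `sum_walkPow_apply'` (column sums `1`), `walkPow_apply_le_one`,
  **`walkPow_apply_eq_zero_of_not_mem`** (started in `Ω`, stays in `Ω`).
* §4 the tilted walk: `tilt_succ`, `tilt_zero`, **`tilt_ell1_le`** (`Σg_m ≤ Λ^m`), **`tilt_sq_succ_le`** (Davies), **`tilt_normalized_step`**.
* §5 the series: `massOp_eq_smul` (`n²(−Δ^N_Ω) + 1 = α(1 − qP)`), **`inv_massOp_apply_eq_series`**, `rem_apply_bounds`
  (`0 ≤ (R(qP)^N)(y,x) ≤ q^N`).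
* §6 **`tilted_col_sq_le_explicit`** (every `P` with `P.d ≤ 3`, explicit `K(P.d, P.L)`, `t ≤ 1/(100·P.d)`) and the packaged
  **`tilted_col_sq_le (d ℓ) : ∃ t₀ K > 0, ∀ P, P.d = d+1 → P.L = ℓ+1 → …`** in the binder shape of p27's `tilted_row_boxR_sq_le`.

HONEST SCOPE.  (i) Free (`A = 0`) lattice analysis on the fine torus `Site P 0`; the covariant, small-field version is assembled in file 4
from p34's `agmon_weighted_region` exactly as in p27's cube file.  (ii) The weight `ψ` is ABSTRACT here (three hypotheses); file 3a's
block-centred `psi` (p34 `BIJ88BlockCentredWeight`: `psi_shift_sub_abs_le`, `psi_shift_eq_of_not_mem_starB`, `psi_drift_le`) discharges them and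
`psi_ge` converts to the `ℓ^∞`-distance weight `e^{t|x−y|_∞/(2L^k)}` in file 4.  (iii) `D = P.d ≤ 3` (the scale sums need `√(L^{4−D}) > 1`);
`k ≤ m + K` (no `k ≥ 1` needed here).  (iv) Constants explicit but not optimised.  Nothing here is summit progress.  Unit `lit-balaban-p34`
(literature-prover-lit-balaban-p34-g18-0), HOME `run/shared/lean/pub/lit-balaban/`, 2026-08-23.  v1.1 DOC-ONLY (same seat, after referee
ref-5 D-g67-2 on file 1): the `kernel` tags of §3–§5 re-pointed from [6]'s «(1.7) p.572» (the regularity condition on `A` — a mislabel) to the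
random walk representation (2.12) p. 577 whose region/reflecting-walk analogue they serve; every declaration byte-identical to v1.0 (p354613).
-/

open scoped BigOperators
open Finset Matrix

namespace Literature.MathematicalPhysics.QuantumFieldTheory.BalabanImbrieJaffe1984to88.BIJ88FreeNeumannResolventRegionTiltedRow

noncomputable section

/-! ## §1 Real-variable lemmas -/

section Reals

/-- kernel: Bernoulli, `(1 − s)^I(1 + Is) ≤ 1` for `0 ≤ s ≤ 1`. [folklore] -/
private theorem one_sub_pow_mul_le {s : ℝ} (hs0 : 0 ≤ s) (hs1 : s ≤ 1) (I : ℕ) : (1 - s) ^ I * (1 + I * s) ≤ 1 := by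
  have h1 : 1 + (I : ℝ) * s ≤ (1 + s) ^ I := one_add_mul_le_pow (by linarith) I
  have h2 : (1 - s) ^ I * (1 + s) ^ I = (1 - s ^ 2) ^ I := by rw [← mul_pow]; congr 1; ring
  have h3 : (1 - s ^ 2) ^ I ≤ 1 := pow_le_one₀ (by nlinarith) (by nlinarith)
  calc (1 - s) ^ I * (1 + I * s) ≤ (1 - s) ^ I * (1 + s) ^ I :=
        mul_le_mul_of_nonneg_left h1 (pow_nonneg (by linarith) _)
    _ ≤ 1 := h2 ▸ h3

/-- kernel: one descent stage — `v_{m+1} ≤ v_m − s(v_m − B)⁺` and `v_{m₀} ≤ B + A` give `v_{m₀+I} ≤ B + (1−s)^I A`. [folklore] -/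
private theorem stage_le (v : ℕ → ℝ) {s B A : ℝ} (hs1 : s ≤ 1) (hA : 0 ≤ A) (m₀ : ℕ)
    (hstep : ∀ m, v (m + 1) ≤ v m - s * max (v m - B) 0) (h0 : v m₀ ≤ B + A) (I : ℕ) :
    v (m₀ + I) ≤ B + (1 - s) ^ I * A := by
  have hE : ∀ m, max (v (m + 1) - B) 0 ≤ (1 - s) * max (v m - B) 0 := by
    intro m
    have h := hstep m
    refine max_le ?_ (mul_nonneg (by linarith) (le_max_right _ _))
    rcases le_or_gt (v m - B) 0 with hneg | hpos
    · rw [max_eq_right hneg] at h ⊢; linarith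
    · rw [max_eq_left hpos.le] at h ⊢; linarith
  have key : ∀ I, max (v (m₀ + I) - B) 0 ≤ (1 - s) ^ I * A := by
    intro I
    induction I with
    | zero => rw [pow_zero, one_mul, Nat.add_zero]; exact max_le (by linarith) hA
    | succ I ih =>
        rw [← Nat.add_assoc]
        calc max (v (m₀ + I + 1) - B) 0 ≤ (1 - s) * max (v (m₀ + I) - B) 0 := hE _
          _ ≤ (1 - s) * ((1 - s) ^ I * A) := mul_le_mul_of_nonneg_left ih (by linarith)
          _ = (1 - s) ^ (I + 1) * A := by ring
  linarith [key I, le_max_left (v (m₀ + I) - B) 0]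

/-- kernel: `Σ_{i<j} L^{2(i+1)} ≤ 2L^{2j}` for `L ≥ 2`. [folklore] -/
private theorem sum_pow_two_mul_le {L : ℕ} (hL : 2 ≤ L) (j : ℕ) : ∑ i ∈ range j, L ^ (2 * (i + 1)) ≤ 2 * L ^ (2 * j) := by
  induction j with
  | zero => simp
  | succ j ih =>
      rw [sum_range_succ]
      have hL2 : 2 ≤ L ^ 2 := le_trans (by norm_num) (Nat.pow_le_pow_left hL 2)
      have e : L ^ (2 * (j + 1)) = L ^ (2 * j) * L ^ 2 := by ring
      rw [e]
      nlinarith [Nat.zero_le (L ^ (2 * j))]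

/-- **THE `L`-ADIC DESCENT LEMMA.**  A sequence `v` with `v₀ ≤ 1` and, for every scale `j ≤ k`,
`v_{m+1} ≤ v_m − (wL^{2j})⁻¹(v_m − L^{−jD})⁺`, satisfies `v_m ≤ 2L^{−jD}` for `m ≥ 4wL^DL^{2j}`. [folklore] -/
private theorem descent (L D w k : ℕ) (hL : 2 ≤ L) (hw : 1 ≤ w) (v : ℕ → ℝ) (hv0 : v 0 ≤ 1)
    (hstep : ∀ j ≤ k, ∀ m, v (m + 1) ≤ v m - ((w : ℝ) * ((L : ℝ) ^ j) ^ 2)⁻¹ * max (v m - (((L : ℝ) ^ j) ^ D)⁻¹) 0) :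
    ∀ j ≤ k, ∀ m : ℕ, 4 * w * L ^ D * L ^ (2 * j) ≤ m → v m ≤ 2 * (((L : ℝ) ^ j) ^ D)⁻¹ := by
  have hLr : (2 : ℝ) ≤ L := by exact_mod_cast hL
  have hLpos : (0 : ℝ) < L := by linarith
  have hwr : (1 : ℝ) ≤ w := by exact_mod_cast hw
  have hmono : ∀ m, v (m + 1) ≤ v m := by
    intro m
    have h := hstep 0 (Nat.zero_le _) m
    have : 0 ≤ ((w : ℝ) * ((L : ℝ) ^ 0) ^ 2)⁻¹ * max (v m - (((L : ℝ) ^ 0) ^ D)⁻¹) 0 :=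
      mul_nonneg (inv_nonneg.2 (by positivity)) (le_max_right _ _)
    linarith
  have hanti : ∀ m, v m ≤ v 0 := by
    intro m
    induction m with
    | zero => exact le_rfl
    | succ m ih => exact (hmono m).trans ih
  have claim : ∀ j ≤ k, ∀ m : ℕ, 2 * w * L ^ D * ∑ i ∈ range j, L ^ (2 * (i + 1)) ≤ m →
      v m ≤ 2 * (((L : ℝ) ^ j) ^ D)⁻¹ := by
    intro j
    induction j with
    | zero =>
        intro _ m _
        have : (((L : ℝ) ^ 0) ^ D)⁻¹ = 1 := by simp
        rw [this]; linarith [hanti m]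
    | succ j ih =>
        intro hjk m hm
        have hj : j ≤ k := (Nat.le_succ j).trans hjk
        have hA := ih hj (2 * w * L ^ D * ∑ i ∈ range j, L ^ (2 * (i + 1))) le_rfl
        have hTm : 2 * w * L ^ D * ∑ i ∈ range j, L ^ (2 * (i + 1)) + 2 * w * L ^ D * L ^ (2 * (j + 1)) ≤ m := by
          rw [sum_range_succ, mul_add] at hm; exact hm
        obtain ⟨I, rfl⟩ : ∃ I, m = 2 * w * L ^ D * ∑ i ∈ range j, L ^ (2 * (i + 1)) + I :=
          ⟨m - 2 * w * L ^ D * ∑ i ∈ range j, L ^ (2 * (i + 1)), by omega⟩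
        have hI : 2 * w * L ^ D * L ^ (2 * (j + 1)) ≤ I := by omega
        have hIr : (2 : ℝ) * w * (L : ℝ) ^ D * ((L : ℝ) ^ (j + 1)) ^ 2 ≤ I := by
          have h : ((2 * w * L ^ D * L ^ (2 * (j + 1)) : ℕ) : ℝ) ≤ I := by exact_mod_cast hI
          push_cast at h
          rw [← pow_mul, mul_comm (j + 1) 2]; exact h
        have hBpos : 0 < (((L : ℝ) ^ (j + 1)) ^ D)⁻¹ := by positivity
        have hn1 : (1 : ℝ) ≤ ((L : ℝ) ^ (j + 1)) ^ 2 := one_le_pow₀ (one_le_pow₀ (by linarith))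
        have hspos : 0 < ((w : ℝ) * ((L : ℝ) ^ (j + 1)) ^ 2)⁻¹ := by positivity
        have hs1 : ((w : ℝ) * ((L : ℝ) ^ (j + 1)) ^ 2)⁻¹ ≤ 1 := inv_le_one_of_one_le₀ (by nlinarith)
        have hst := stage_le v hs1 (by positivity : (0 : ℝ) ≤ 2 * (((L : ℝ) ^ j) ^ D)⁻¹) _
          (fun m => hstep (j + 1) hjk m) (by linarith) I
        have hbern := one_sub_pow_mul_le hspos.le hs1 I
        -- `I·s ≥ 2L^D` and `A = B·2L^D`
        have hIs : (2 : ℝ) * (L : ℝ) ^ D ≤ I * ((w : ℝ) * ((L : ℝ) ^ (j + 1)) ^ 2)⁻¹ := by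
          rw [← div_eq_mul_inv, le_div_iff₀ (by positivity)]; linarith
        have hAB : 2 * (((L : ℝ) ^ j) ^ D)⁻¹ = (((L : ℝ) ^ (j + 1)) ^ D)⁻¹ * (2 * (L : ℝ) ^ D) := by
          rw [pow_succ, mul_pow]; field_simp
        have hkey : (1 - ((w : ℝ) * ((L : ℝ) ^ (j + 1)) ^ 2)⁻¹) ^ I * (2 * (((L : ℝ) ^ j) ^ D)⁻¹) ≤ (((L : ℝ) ^ (j + 1)) ^ D)⁻¹ := by
          have h1 : 0 ≤ (1 - ((w : ℝ) * ((L : ℝ) ^ (j + 1)) ^ 2)⁻¹) ^ I := pow_nonneg (by linarith) _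
          calc (1 - ((w : ℝ) * ((L : ℝ) ^ (j + 1)) ^ 2)⁻¹) ^ I * (2 * (((L : ℝ) ^ j) ^ D)⁻¹)
              ≤ (1 - ((w : ℝ) * ((L : ℝ) ^ (j + 1)) ^ 2)⁻¹) ^ I *
                  ((((L : ℝ) ^ (j + 1)) ^ D)⁻¹ * (1 + I * ((w : ℝ) * ((L : ℝ) ^ (j + 1)) ^ 2)⁻¹)) := by
                refine mul_le_mul_of_nonneg_left ?_ h1
                rw [hAB]; exact mul_le_mul_of_nonneg_left (by linarith) hBpos.le
            _ = (((L : ℝ) ^ (j + 1)) ^ D)⁻¹ * ((1 - ((w : ℝ) * ((L : ℝ) ^ (j + 1)) ^ 2)⁻¹) ^ I *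
                  (1 + I * ((w : ℝ) * ((L : ℝ) ^ (j + 1)) ^ 2)⁻¹)) := by ring
            _ ≤ (((L : ℝ) ^ (j + 1)) ^ D)⁻¹ * 1 := mul_le_mul_of_nonneg_left hbern hBpos.le
            _ = _ := mul_one _
        linarith
  intro j hj m hm
  refine claim j hj m (le_trans ?_ hm)
  have h := sum_pow_two_mul_le hL j
  calc 2 * w * L ^ D * ∑ i ∈ range j, L ^ (2 * (i + 1)) ≤ 2 * w * L ^ D * (2 * L ^ (2 * j)) := Nat.mul_le_mul_left _ h
    _ = 4 * w * L ^ D * L ^ (2 * j) := by ring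

/-- kernel: **pointwise scale bound** — if `v ≤ 1` and `v_m ≤ 2L^{−jD}` for `m ≥ WL^{2j}` (`j ≤ k`), then for every `m`
`√v_m ≤ [m < W] + Σ_{j<k}[m < WL^{2(j+1)}]·√2/√(L^{jD}) + √2/√(L^{kD})`. [folklore] -/
private theorem sqrt_le_scaleSum (L D W k : ℕ) (v : ℕ → ℝ) (hv1 : ∀ m, v m ≤ 1)
    (hv : ∀ j ≤ k, ∀ m : ℕ, W * L ^ (2 * j) ≤ m → v m ≤ 2 * (((L : ℝ) ^ j) ^ D)⁻¹) (m : ℕ) :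
    Real.sqrt (v m) ≤ (if m < W then (1 : ℝ) else 0) +
      ∑ j ∈ range k, (if m < W * L ^ (2 * (j + 1)) then Real.sqrt 2 / Real.sqrt (((L : ℝ) ^ j) ^ D) else 0) +
      Real.sqrt 2 / Real.sqrt (((L : ℝ) ^ k) ^ D) := by
  have hnn1 : 0 ≤ (if m < W then (1 : ℝ) else 0) := by split_ifs <;> norm_num
  have hnn2 : ∀ j, 0 ≤ (if m < W * L ^ (2 * (j + 1)) then Real.sqrt 2 / Real.sqrt (((L : ℝ) ^ j) ^ D) else 0) :=
    fun j => by split_ifs <;> positivity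
  have hnn3 : 0 ≤ Real.sqrt 2 / Real.sqrt (((L : ℝ) ^ k) ^ D) := by positivity
  have hS : 0 ≤ ∑ j ∈ range k, (if m < W * L ^ (2 * (j + 1)) then Real.sqrt 2 / Real.sqrt (((L : ℝ) ^ j) ^ D) else 0) :=
    sum_nonneg fun j _ => hnn2 j
  have hsq : ∀ j ≤ k, W * L ^ (2 * j) ≤ m → Real.sqrt (v m) ≤ Real.sqrt 2 / Real.sqrt (((L : ℝ) ^ j) ^ D) := by
    intro j hj hm
    rw [← Real.sqrt_div zero_le_two]
    exact Real.sqrt_le_sqrt (by rw [div_eq_mul_inv]; exact hv j hj m hm)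
  by_cases h1 : m < W
  · have : Real.sqrt (v m) ≤ 1 := by rw [← Real.sqrt_one]; exact Real.sqrt_le_sqrt (hv1 m)
    rw [if_pos h1]; linarith
  · rw [if_neg h1]
    rw [not_lt] at h1
    by_cases h2 : W * L ^ (2 * k) ≤ m
    · have := hsq k le_rfl h2; linarith
    · rw [not_le] at h2
      have hex : ∃ j, m < W * L ^ (2 * j) := ⟨k, h2⟩
      have hspec : m < W * L ^ (2 * Nat.find hex) := Nat.find_spec hex
      have hfk : Nat.find hex ≤ k := Nat.find_min' hex h2
      have hf0 : Nat.find hex ≠ 0 := by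
        intro h0; rw [h0] at hspec; simp at hspec; omega
      have hmj : W * L ^ (2 * (Nat.find hex - 1)) ≤ m := by
        by_contra hlt
        exact Nat.find_min hex (show Nat.find hex - 1 < Nat.find hex by omega) (not_le.1 hlt)
      have hjr : Nat.find hex - 1 ∈ range k := mem_range.2 (by omega)
      have hb := hsq (Nat.find hex - 1) (by omega) hmj
      have hterm : Real.sqrt 2 / Real.sqrt (((L : ℝ) ^ (Nat.find hex - 1)) ^ D) ≤
          ∑ j ∈ range k, (if m < W * L ^ (2 * (j + 1)) then Real.sqrt 2 / Real.sqrt (((L : ℝ) ^ j) ^ D) else 0) := by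
        have h := single_le_sum (f := fun j => if m < W * L ^ (2 * (j + 1)) then Real.sqrt 2 / Real.sqrt (((L : ℝ) ^ j) ^ D) else 0)
          (fun j _ => hnn2 j) hjr
        have e : Nat.find hex - 1 + 1 = Nat.find hex := by omega
        simp only [e, if_pos hspec] at h
        exact h
      linarith

/-- kernel: **the weighted scale sum** — with `v` as in `sqrt_le_scaleSum` and `0 ≤ r < 1`, for every `N`,
`Σ_{m<N} r^m√v_m ≤ W + Σ_{j<k} WL^{2(j+1)}·√2/√(L^{jD}) + (1 − r)⁻¹·√2/√(L^{kD})`. [folklore] -/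
private theorem sum_geom_sqrt_le (L D W k : ℕ) (v : ℕ → ℝ) (hv1 : ∀ m, v m ≤ 1)
    (hv : ∀ j ≤ k, ∀ m : ℕ, W * L ^ (2 * j) ≤ m → v m ≤ 2 * (((L : ℝ) ^ j) ^ D)⁻¹) {r : ℝ} (hr0 : 0 ≤ r) (hr1 : r < 1)
    (N : ℕ) :
    ∑ m ∈ range N, r ^ m * Real.sqrt (v m) ≤
      W + ∑ j ∈ range k, ((W * L ^ (2 * (j + 1)) : ℕ) : ℝ) * (Real.sqrt 2 / Real.sqrt (((L : ℝ) ^ j) ^ D)) +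
        (1 - r)⁻¹ * (Real.sqrt 2 / Real.sqrt (((L : ℝ) ^ k) ^ D)) := by
  have hcount : ∀ M : ℕ, ∑ m ∈ range N, (if m < M then (1 : ℝ) else 0) ≤ M := by
    intro M
    rw [← sum_filter, sum_const, nsmul_eq_mul, mul_one]
    have : ((range N).filter (fun m => m < M)).card ≤ M := by
      calc ((range N).filter (fun m => m < M)).card ≤ (range M).card :=
            card_le_card fun m hm => by simp only [mem_filter, mem_range] at hm ⊢; exact hm.2
        _ = M := card_range M
    exact_mod_cast this
  have h1r : 0 < 1 - r := by linarith
  have hgeom : ∑ m ∈ range N, r ^ m ≤ (1 - r)⁻¹ := by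
    have h := geom_sum_mul_neg r N
    have e : ∑ m ∈ range N, r ^ m = (1 - r ^ N) / (1 - r) := by rw [eq_div_iff h1r.ne']; exact h
    rw [e, div_le_iff₀ h1r, inv_mul_cancel₀ h1r.ne']
    linarith [pow_nonneg hr0 N]
  have hrm : ∀ m, r ^ m ≤ 1 := fun m => pow_le_one₀ hr0 hr1.le
  have hpt := sqrt_le_scaleSum L D W k v hv1 hv
  set T : ℝ := Real.sqrt 2 / Real.sqrt (((L : ℝ) ^ k) ^ D) with hT
  have hT0 : 0 ≤ T := by positivity
  set c : ℕ → ℝ := fun j => Real.sqrt 2 / Real.sqrt (((L : ℝ) ^ j) ^ D) with hc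
  have hc0 : ∀ j, 0 ≤ c j := fun j => by positivity
  have hH0 : ∀ m : ℕ, 0 ≤ (if m < W then (1 : ℝ) else 0) := fun m => by split_ifs <;> norm_num
  have hM0 : ∀ m j : ℕ, 0 ≤ (if m < W * L ^ (2 * (j + 1)) then c j else 0) := fun m j => by
    split_ifs
    · exact hc0 j
    · exact le_rfl
  calc ∑ m ∈ range N, r ^ m * Real.sqrt (v m)
      ≤ ∑ m ∈ range N, ((if m < W then (1 : ℝ) else 0) +
          ∑ j ∈ range k, (if m < W * L ^ (2 * (j + 1)) then c j else 0) + r ^ m * T) := by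
        refine sum_le_sum fun m _ => ?_
        have h := hpt m
        have hS : 0 ≤ ∑ j ∈ range k, (if m < W * L ^ (2 * (j + 1)) then c j else 0) := sum_nonneg fun j _ => hM0 m j
        have h2 : r ^ m * ((if m < W then (1 : ℝ) else 0) + ∑ j ∈ range k, (if m < W * L ^ (2 * (j + 1)) then c j else 0) + T)
            ≤ (if m < W then (1 : ℝ) else 0) + ∑ j ∈ range k, (if m < W * L ^ (2 * (j + 1)) then c j else 0) + r ^ m * T := by
          have h3 : r ^ m * ((if m < W then (1 : ℝ) else 0) + ∑ j ∈ range k, (if m < W * L ^ (2 * (j + 1)) then c j else 0)) ≤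
              1 * ((if m < W then (1 : ℝ) else 0) + ∑ j ∈ range k, (if m < W * L ^ (2 * (j + 1)) then c j else 0)) :=
            mul_le_mul_of_nonneg_right (hrm m) (add_nonneg (hH0 m) hS)
          linarith
        exact (mul_le_mul_of_nonneg_left h (pow_nonneg hr0 m)).trans h2
    _ = ∑ m ∈ range N, (if m < W then (1 : ℝ) else 0) +
          ∑ j ∈ range k, ∑ m ∈ range N, (if m < W * L ^ (2 * (j + 1)) then c j else 0) + (∑ m ∈ range N, r ^ m) * T := by
        rw [sum_add_distrib, sum_add_distrib, sum_mul, sum_comm]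
    _ ≤ W + ∑ j ∈ range k, ((W * L ^ (2 * (j + 1)) : ℕ) : ℝ) * c j + (1 - r)⁻¹ * T := by
        refine add_le_add (add_le_add (hcount W) (sum_le_sum fun j _ => ?_)) (mul_le_mul_of_nonneg_right hgeom hT0)
        have e : ∑ m ∈ range N, (if m < W * L ^ (2 * (j + 1)) then c j else 0) =
            (∑ m ∈ range N, (if m < W * L ^ (2 * (j + 1)) then (1 : ℝ) else 0)) * c j := by
          rw [sum_mul]; exact sum_congr rfl fun m _ => by split_ifs <;> simp
        rw [e]
        exact mul_le_mul_of_nonneg_right (hcount _) (hc0 j)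

/-- kernel: `(√a)^j = √(a^j)` for `a ≥ 0`. [folklore] -/
private theorem sqrt_pow_eq {a : ℝ} (ha : 0 ≤ a) (j : ℕ) : Real.sqrt a ^ j = Real.sqrt (a ^ j) := by
  rw [← Real.sqrt_sq (pow_nonneg (Real.sqrt_nonneg a) j), ← pow_mul, mul_comm, pow_mul, Real.sq_sqrt ha]

/-- kernel: the scale identity `(L^j)²/√((L^j)^D) = (√(L^{4−D}))^j` (`D ≤ 4`). [folklore] -/
private theorem scale_identity {L : ℝ} (hL : 0 < L) {D : ℕ} (hD : D ≤ 4) (j : ℕ) :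
    ((L ^ j) ^ 2) / Real.sqrt ((L ^ j) ^ D) = Real.sqrt (L ^ (4 - D)) ^ j := by
  have hn : 0 < L ^ j := pow_pos hL j
  have e1 : Real.sqrt (L ^ (4 - D)) ^ j = Real.sqrt ((L ^ j) ^ (4 - D)) := by
    rw [sqrt_pow_eq (pow_nonneg hL.le _), ← pow_mul, ← pow_mul, mul_comm]
  have e2 : (L ^ j) ^ 2 = Real.sqrt ((L ^ j) ^ 4) := by
    rw [show (L ^ j) ^ 4 = ((L ^ j) ^ 2) ^ 2 by ring, Real.sqrt_sq (by positivity)]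
  rw [e1, e2, ← Real.sqrt_div (by positivity), pow_sub₀ _ hn.ne' hD, div_eq_mul_inv]

/-- kernel: **the scale bookkeeping** — for `L ≥ 2`, `D ≤ 3`:
`W + Σ_{j<k} WL^{2(j+1)}√2/√(L^{jD}) ≤ W(1 + √2L²/(√(L^{4−D}) − 1))·(L^k)²/√((L^k)^D)`. [folklore] -/
private theorem scaleSum_le (L D W k : ℕ) (hL : 2 ≤ L) (hD : D ≤ 3) :
    (W : ℝ) + ∑ j ∈ range k, ((W * L ^ (2 * (j + 1)) : ℕ) : ℝ) * (Real.sqrt 2 / Real.sqrt (((L : ℝ) ^ j) ^ D)) ≤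
      (W * (1 + Real.sqrt 2 * (L : ℝ) ^ 2 / (Real.sqrt ((L : ℝ) ^ (4 - D)) - 1))) *
        (((L : ℝ) ^ k) ^ 2 / Real.sqrt (((L : ℝ) ^ k) ^ D)) := by
  have hLr : (2 : ℝ) ≤ L := by exact_mod_cast hL
  have hLpos : (0 : ℝ) < L := by linarith
  have hD4 : D ≤ 4 := by omega
  have hW : (0 : ℝ) ≤ W := Nat.cast_nonneg W
  set γ : ℝ := Real.sqrt ((L : ℝ) ^ (4 - D)) with hγ
  have hγ1 : 1 < γ := by
    rw [hγ, show (1 : ℝ) = Real.sqrt 1 from Real.sqrt_one.symm]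
    refine Real.sqrt_lt_sqrt zero_le_one ?_
    calc (1 : ℝ) < 2 := one_lt_two
      _ ≤ L := hLr
      _ = (L : ℝ) ^ 1 := (pow_one _).symm
      _ ≤ (L : ℝ) ^ (4 - D) := pow_le_pow_right₀ (by linarith) (by omega)
  have hγpos : 0 < γ := zero_lt_one.trans hγ1
  set Q : ℝ := ((L : ℝ) ^ k) ^ 2 / Real.sqrt (((L : ℝ) ^ k) ^ D) with hQ
  have hQγ : Q = γ ^ k := scale_identity hLpos hD4 k
  -- `1 ≤ Q`
  have hQ1 : 1 ≤ Q := by rw [hQγ]; exact one_le_pow₀ hγ1.le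
  -- the middle sum
  have hmid : ∑ j ∈ range k, ((W * L ^ (2 * (j + 1)) : ℕ) : ℝ) * (Real.sqrt 2 / Real.sqrt (((L : ℝ) ^ j) ^ D)) =
      W * Real.sqrt 2 * (L : ℝ) ^ 2 * ∑ j ∈ range k, γ ^ j := by
    rw [mul_sum]
    refine sum_congr rfl fun j _ => ?_
    rw [← scale_identity hLpos hD4 j]
    push_cast
    rw [show (2 * (j + 1) : ℕ) = j * 2 + 2 by ring, pow_add, pow_mul]
    field_simp
  have hgs : ∑ j ∈ range k, γ ^ j ≤ Q / (γ - 1) := by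
    rw [geom_sum_eq hγ1.ne' k, hQγ]
    exact div_le_div_of_nonneg_right (by linarith) (by linarith)
  rw [hmid]
  have h2 : W * Real.sqrt 2 * (L : ℝ) ^ 2 * ∑ j ∈ range k, γ ^ j ≤ W * Real.sqrt 2 * (L : ℝ) ^ 2 * (Q / (γ - 1)) :=
    mul_le_mul_of_nonneg_left hgs (by positivity)
  have h1 : (W : ℝ) ≤ W * Q := le_mul_of_one_le_right hW hQ1
  have e : (W * (1 + Real.sqrt 2 * (L : ℝ) ^ 2 / (γ - 1))) * Q = W * Q + W * Real.sqrt 2 * (L : ℝ) ^ 2 * (Q / (γ - 1)) := by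
    ring
  rw [e]
  exact add_le_add h1 h2

/-! ### Minkowski in `ℓ²` of a finite set, by hand -/

/-- kernel: `Σfg ≤ √(Σf²)·√(Σg²)`. [folklore] -/
private theorem sum_mul_le_sqrt_mul_sqrt {ι : Type*} (s : Finset ι) (f g : ι → ℝ) :
    ∑ i ∈ s, f i * g i ≤ Real.sqrt (∑ i ∈ s, f i ^ 2) * Real.sqrt (∑ i ∈ s, g i ^ 2) := by
  rw [← Real.sqrt_mul (sum_nonneg fun i _ => sq_nonneg (f i))]
  exact (le_abs_self _).trans (Real.abs_le_sqrt (sum_mul_sq_le_sq_mul_sq s f g))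

/-- kernel: **Minkowski**, `√(Σ(f+g)²) ≤ √(Σf²) + √(Σg²)`. [folklore] -/
private theorem sqrt_sum_sq_add_le {ι : Type*} (s : Finset ι) (f g : ι → ℝ) :
    Real.sqrt (∑ i ∈ s, (f i + g i) ^ 2) ≤ Real.sqrt (∑ i ∈ s, f i ^ 2) + Real.sqrt (∑ i ∈ s, g i ^ 2) := by
  have hA := Real.sqrt_nonneg (∑ i ∈ s, f i ^ 2)
  have hB := Real.sqrt_nonneg (∑ i ∈ s, g i ^ 2)
  rw [← Real.sqrt_sq (add_nonneg hA hB)]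
  refine Real.sqrt_le_sqrt ?_
  have e : ∑ i ∈ s, (f i + g i) ^ 2 = ∑ i ∈ s, f i ^ 2 + 2 * ∑ i ∈ s, f i * g i + ∑ i ∈ s, g i ^ 2 := by
    rw [mul_sum, ← sum_add_distrib, ← sum_add_distrib]; exact sum_congr rfl fun i _ => by ring
  rw [e, add_sq, Real.sq_sqrt (sum_nonneg fun i _ => sq_nonneg (f i)), Real.sq_sqrt (sum_nonneg fun i _ => sq_nonneg (g i))]
  linarith [sum_mul_le_sqrt_mul_sqrt s f g]

/-- kernel: **Minkowski for a finite family**, `√(Σ_i(Σ_mh_m(i))²) ≤ Σ_m√(Σ_ih_m(i)²)`. [folklore] -/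
private theorem sqrt_sum_sq_sum_le {ι κ : Type*} (s : Finset ι) (T : Finset κ) (h : κ → ι → ℝ) :
    Real.sqrt (∑ i ∈ s, (∑ m ∈ T, h m i) ^ 2) ≤ ∑ m ∈ T, Real.sqrt (∑ i ∈ s, h m i ^ 2) := by
  classical
  induction T using Finset.induction_on with
  | empty => simp
  | insert a T ha ih =>
      rw [sum_insert ha]
      simp_rw [sum_insert ha]
      exact (sqrt_sum_sq_add_le s (h a) (fun i => ∑ m ∈ T, h m i)).trans (add_le_add le_rfl ih)

/-- kernel: `√(Σ(cf)²) = c√(Σf²)` for `c ≥ 0`. [folklore] -/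
private theorem sqrt_sum_sq_mul {ι : Type*} (s : Finset ι) (f : ι → ℝ) {c : ℝ} (hc : 0 ≤ c) :
    Real.sqrt (∑ i ∈ s, (c * f i) ^ 2) = c * Real.sqrt (∑ i ∈ s, f i ^ 2) := by
  have e : ∑ i ∈ s, (c * f i) ^ 2 = c ^ 2 * ∑ i ∈ s, f i ^ 2 := by
    rw [mul_sum]; exact sum_congr rfl fun i _ => by ring
  rw [e, Real.sqrt_mul' _ (sum_nonneg fun i _ => sq_nonneg (f i)), Real.sqrt_sq hc]

/-- kernel: `√(Σ_{i∈s}f²) ≤ √|s|·c` when `|f| ≤ c` on `s`. [folklore] -/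
private theorem sqrt_sum_sq_le_of_abs_le {ι : Type*} (s : Finset ι) (f : ι → ℝ) {c : ℝ} (hc : 0 ≤ c) (hf : ∀ i ∈ s, |f i| ≤ c) :
    Real.sqrt (∑ i ∈ s, f i ^ 2) ≤ Real.sqrt s.card * c := by
  rw [← Real.sqrt_sq hc, ← Real.sqrt_mul (Nat.cast_nonneg _)]
  refine Real.sqrt_le_sqrt ?_
  rw [← nsmul_eq_mul, ← sum_const]
  exact sum_le_sum fun i hi => sq_le_sq' (abs_le.1 (hf i hi)).1 (abs_le.1 (hf i hi)).2

end Reals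

/-! ## §2 More real lemmas: monotonicity from the step, the normalised step, the smallness of `Θ − 1` -/

section Reals2

/-- kernel: a step hypothesis `v_{m+1} ≤ v_m − c·(…)⁺` with `c ≥ 0` makes `v` non-increasing: `v_m ≤ v_0`. [folklore] -/
private theorem le_init_of_step (v : ℕ → ℝ) {c B : ℝ} (hc : 0 ≤ c) (hstep : ∀ m, v (m + 1) ≤ v m - c * max (v m - B) 0) (m : ℕ) :
    v m ≤ v 0 := by
  induction m with
  | zero => exact le_rfl
  | succ m ih =>
      have h := hstep m
      have : 0 ≤ c * max (v m - B) 0 := mul_nonneg hc (le_max_right _ _)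
      linarith

/-- kernel: **the normalised Nash–Davies step** (pure algebra).  From the Davies step `u′ ≤ (1+τ²)u − θE`, the Nash inequality
`u ≤ (n_j²/2)E + n_j^{−D}a²`, `E ≥ 0`, the `ℓ¹` control `a² ≤ T`, and `Θ = (1+τ²)Λ² ≤ 4`, `Λ ≥ 1`, `θ = (8D)⁻¹`:
`u′/(TΘ) ≤ u/T − (16Dn_j²)⁻¹(u/T − n_j^{−D})⁺`. [folklore] -/
private theorem normalized_step {D nj u u' a E T τ Λ Θ : ℝ} (Dn : ℕ) (hD : 0 < D) (hnj : 0 < nj) (hu : 0 ≤ u)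
    (hstep : u' ≤ (1 + τ ^ 2) * u - (8 * D)⁻¹ * E) (hnash : u ≤ nj ^ 2 / 2 * E + (nj ^ Dn)⁻¹ * a ^ 2) (hE : 0 ≤ E)
    (hT : 0 < T) (ha : a ^ 2 ≤ T) (hΘ : Θ = (1 + τ ^ 2) * Λ ^ 2) (hΛ : 1 ≤ Λ) (hΘ4 : Θ ≤ 4) :
    u' / (T * Θ) ≤ u / T - (16 * D * nj ^ 2)⁻¹ * max (u / T - (nj ^ Dn)⁻¹) 0 := by
  have hΛ2 : 1 ≤ Λ ^ 2 := one_le_pow₀ hΛ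
  have hτ2 : 1 ≤ 1 + τ ^ 2 := by nlinarith [sq_nonneg τ]
  have hΘ1 : 1 + τ ^ 2 ≤ Θ := by rw [hΘ]; nlinarith
  have hΘpos : 0 < Θ := by linarith
  have hTΘ : 0 < T * Θ := mul_pos hT hΘpos
  have hnj2 : 0 < nj ^ 2 := pow_pos hnj 2
  have hnD : 0 ≤ (nj ^ Dn)⁻¹ := inv_nonneg.2 (pow_nonneg hnj.le _)
  set Mx : ℝ := max (u / T - (nj ^ Dn)⁻¹) 0 with hMx
  have hMx0 : 0 ≤ Mx := le_max_right _ _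
  -- `T·Mx ≤ (n_j²/2)E`
  have hTM : T * Mx ≤ nj ^ 2 / 2 * E := by
    have e1 : T * Mx = max (u - (nj ^ Dn)⁻¹ * T) 0 := by
      rw [hMx, mul_max_of_nonneg _ _ hT.le, mul_zero, mul_sub, mul_div_cancel₀ _ hT.ne', mul_comm T]
    rw [e1]
    refine max_le ?_ (by positivity)
    nlinarith [mul_le_mul_of_nonneg_left ha hnD]
  -- `u′ ≤ Θu − (TΘ/(16Dn_j²))Mx`
  have h1 : u' ≤ Θ * u - T * Θ / (16 * D * nj ^ 2) * Mx := by
    have h2 : (1 + τ ^ 2) * u ≤ Θ * u := mul_le_mul_of_nonneg_right hΘ1 hu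
    have h3 : T * Θ / (16 * D * nj ^ 2) * Mx ≤ (8 * D)⁻¹ * E := by
      have h4 : T * Θ / (16 * D * nj ^ 2) * Mx ≤ T * 4 / (16 * D * nj ^ 2) * Mx :=
        mul_le_mul_of_nonneg_right (div_le_div_of_nonneg_right (mul_le_mul_of_nonneg_left hΘ4 hT.le) (by positivity)) hMx0
      have h5 : T * 4 / (16 * D * nj ^ 2) * Mx = (8 * D)⁻¹ * ((2 / nj ^ 2) * (T * Mx)) := by
        field_simp; ring
      have h6 : (2 / nj ^ 2) * (T * Mx) ≤ E := by
        rw [div_mul_eq_mul_div, div_le_iff₀ hnj2]; nlinarith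
      calc T * Θ / (16 * D * nj ^ 2) * Mx ≤ T * 4 / (16 * D * nj ^ 2) * Mx := h4
        _ = (8 * D)⁻¹ * ((2 / nj ^ 2) * (T * Mx)) := h5
        _ ≤ (8 * D)⁻¹ * E := mul_le_mul_of_nonneg_left h6 (by positivity)
    linarith
  have e2 : Θ * u - T * Θ / (16 * D * nj ^ 2) * Mx = (T * Θ) * (u / T - (16 * D * nj ^ 2)⁻¹ * Mx) := by
    field_simp
  rw [div_le_iff₀ hTΘ, mul_comm _ (T * Θ), ← e2]
  exact h1

/-- kernel: **smallness of `Θ − 1`** — for `0 ≤ t ≤ 1/(100D)`, `D ≥ 1`, `n ≥ 1`: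
`(1 + (t/n)²)(1 + (8D)⁻¹·D(8t + 2t²)/n²)² ≤ 1 + (8Dn²)⁻¹`. [folklore] -/
private theorem theta_le {t n D : ℝ} (hD : 1 ≤ D) (hn : 1 ≤ n) (ht0 : 0 ≤ t) (ht : t ≤ 1 / (100 * D)) :
    (1 + (t / n) ^ 2) * (1 + (8 * D)⁻¹ * (D * ((8 * t + 2 * t ^ 2) / n ^ 2))) ^ 2 ≤ 1 + (8 * D * n ^ 2)⁻¹ := by
  have hDpos : 0 < D := by linarith
  have hn2 : 1 ≤ n ^ 2 := one_le_pow₀ hn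
  have hn2pos : 0 < n ^ 2 := by linarith
  have ht1 : t ≤ 1 / 100 := ht.trans (one_div_le_one_div_of_le (by norm_num) (by nlinarith))
  have e1 : (8 * D)⁻¹ * (D * ((8 * t + 2 * t ^ 2) / n ^ 2)) = (t + t ^ 2 / 4) * (n ^ 2)⁻¹ := by
    field_simp; ring
  have e2 : (t / n) ^ 2 = t ^ 2 * (n ^ 2)⁻¹ := by rw [div_pow, div_eq_mul_inv]
  have e3 : (8 * D * n ^ 2)⁻¹ = (8 * D)⁻¹ * (n ^ 2)⁻¹ := by rw [mul_inv]
  rw [e1, e2, e3]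
  set X : ℝ := (n ^ 2)⁻¹ with hX
  have hX0 : 0 < X := inv_pos.2 hn2pos
  have hX1 : X ≤ 1 := inv_le_one_of_one_le₀ hn2
  have hμ : (t + t ^ 2 / 4) * X ≤ 2 * t * X := by nlinarith
  have hμ0 : 0 ≤ (t + t ^ 2 / 4) * X := by positivity
  have hμ1 : (t + t ^ 2 / 4) * X ≤ 1 := by nlinarith
  have hb : (1 + (t + t ^ 2 / 4) * X) ^ 2 ≤ 1 + 3 * ((t + t ^ 2 / 4) * X) := by nlinarith
  have hc : 1 + t ^ 2 * X ≤ 1 + t * X := by nlinarith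
  have htX : t * X ≤ 1 / 100 := by nlinarith
  have hd : (1 + t * X) * (1 + 3 * (2 * t * X)) ≤ 1 + 8 * (t * X) := by nlinarith
  have he : 8 * (t * X) ≤ (8 * D)⁻¹ * X := by
    have h8 : 8 * t ≤ (8 * D)⁻¹ := by
      have e : 8 * (1 / (100 * D)) ≤ (8 * D)⁻¹ := by
        rw [← one_div, mul_one_div, div_le_div_iff₀ (by positivity) (by positivity)]
        nlinarith
      linarith
    nlinarith
  calc (1 + t ^ 2 * X) * (1 + (t + t ^ 2 / 4) * X) ^ 2 ≤ (1 + t * X) * (1 + 3 * ((t + t ^ 2 / 4) * X)) :=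
        mul_le_mul hc hb (sq_nonneg _) (by positivity)
    _ ≤ (1 + t * X) * (1 + 3 * (2 * t * X)) := mul_le_mul_of_nonneg_left (by linarith) (by positivity)
    _ ≤ 1 + 8 * (t * X) := hd
    _ ≤ 1 + (8 * D)⁻¹ * X := by linarith

/-- kernel: `(1 − α⁻¹) ≤ (1 − (2α)⁻¹)²`. [folklore] -/
private theorem one_sub_inv_le_sq (α : ℝ) : 1 - α⁻¹ ≤ (1 - (2 * α)⁻¹) ^ 2 := by
  have e : (1 - (2 * α)⁻¹) ^ 2 = 1 - α⁻¹ + ((2 * α)⁻¹) ^ 2 := by rw [mul_inv]; ring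
  rw [e]
  exact le_add_of_nonneg_right (sq_nonneg _)

/-- kernel: `q^i√(Θ^i v) ≤ r^i√v` when `q²Θ ≤ r²` (`q, r, Θ, v ≥ 0`). [folklore] -/
private theorem geom_sqrt_le {q r Θ v : ℝ} (i : ℕ) (hq : 0 ≤ q) (hr : 0 ≤ r) (hΘ : 0 ≤ Θ) (hv : 0 ≤ v) (h : q ^ 2 * Θ ≤ r ^ 2) :
    q ^ i * Real.sqrt (Θ ^ i * v) ≤ r ^ i * Real.sqrt v := by
  have hqi : q ^ i = Real.sqrt ((q ^ 2) ^ i) := by rw [← sqrt_pow_eq (sq_nonneg q), Real.sqrt_sq hq]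
  have hri : r ^ i = Real.sqrt ((r ^ 2) ^ i) := by rw [← sqrt_pow_eq (sq_nonneg r), Real.sqrt_sq hr]
  rw [hqi, hri, ← Real.sqrt_mul (pow_nonneg (sq_nonneg q) i), ← Real.sqrt_mul (pow_nonneg (sq_nonneg r) i)]
  refine Real.sqrt_le_sqrt ?_
  have h1 : (q ^ 2) ^ i * Θ ^ i ≤ (r ^ 2) ^ i := by
    rw [← mul_pow]; exact pow_le_pow_left₀ (by positivity) h i
  calc (q ^ 2) ^ i * (Θ ^ i * v) = ((q ^ 2) ^ i * Θ ^ i) * v := by ring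
    _ ≤ (r ^ 2) ^ i * v := mul_le_mul_of_nonneg_right h1 hv

end Reals2

/-! ## §3 Powers of the reflecting walk `P = 1 − (8D)⁻¹(−Δ^N_Ω)` -/

section Walk

open Literature.MathematicalPhysics.QuantumFieldTheory.Balaban1983to89
open BIJ88Sect3Statements (starB mem_starB)
open BIJ88NeumannNoZeroModesTorus (IsBlockUnion)
open BIJ88FreeNeumannLaplacianRegion
open BIJ88BlockUnionNash (nash_blockUnion)

variable {P : Params}

/-- kernel: the powers of the walk have nonnegative entries. [cite: Balaban1983RegularityDecay, (2.12) p.577] -/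
theorem walkPow_apply_nonneg (Ω : Finset (Balaban1983to89.Site P 0)) (m : ℕ) (z y : Balaban1983to89.Site P 0) :
    0 ≤ (((1 : Matrix (Balaban1983to89.Site P 0) (Balaban1983to89.Site P 0) ℝ) - (8 * (P.d : ℝ))⁻¹ • lapN Ω) ^ m) z y := by
  induction m generalizing y with
  | zero => rw [pow_zero, Matrix.one_apply]; split_ifs <;> norm_num
  | succ m ih =>
      rw [pow_succ, Matrix.mul_apply]
      exact sum_nonneg fun w _ => mul_nonneg (ih w) (walk_apply_nonneg Ω w y)

/-- kernel: the powers of the walk have column sums `1`. [cite: Balaban1983RegularityDecay, (2.12) p.577] -/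
theorem sum_walkPow_apply' (Ω : Finset (Balaban1983to89.Site P 0)) (m : ℕ) (y : Balaban1983to89.Site P 0) :
    ∑ z, (((1 : Matrix (Balaban1983to89.Site P 0) (Balaban1983to89.Site P 0) ℝ) - (8 * (P.d : ℝ))⁻¹ • lapN Ω) ^ m) z y = 1 := by
  induction m generalizing y with
  | zero =>
      simp_rw [pow_zero, Matrix.one_apply]
      rw [Finset.sum_ite_eq' univ y, if_pos (mem_univ _)]
  | succ m ih =>
      simp_rw [pow_succ', Matrix.mul_apply]
      rw [Finset.sum_comm]
      simp_rw [← Finset.sum_mul, sum_walk_apply' Ω, one_mul]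
      exact ih y

/-- kernel: the entries of the powers of the walk are at most `1`. [cite: Balaban1983RegularityDecay, (2.12) p.577] -/
theorem walkPow_apply_le_one (Ω : Finset (Balaban1983to89.Site P 0)) (m : ℕ) (z y : Balaban1983to89.Site P 0) :
    (((1 : Matrix (Balaban1983to89.Site P 0) (Balaban1983to89.Site P 0) ℝ) - (8 * (P.d : ℝ))⁻¹ • lapN Ω) ^ m) z y ≤ 1 := by
  rw [← sum_walkPow_apply' Ω m y]
  exact single_le_sum (f := fun z => (((1 : Matrix (Balaban1983to89.Site P 0) (Balaban1983to89.Site P 0) ℝ) -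
    (8 * (P.d : ℝ))⁻¹ • lapN Ω) ^ m) z y) (fun z _ => walkPow_apply_nonneg Ω m z y) (mem_univ z)

/-- kernel: **the walk started in `Ω` stays in `Ω`**: `P^m(z,x) = 0` for `x ∈ Ω`, `z ∉ Ω`. [cite: Balaban1983RegularityDecay, (2.12) p.577] -/
theorem walkPow_apply_eq_zero_of_not_mem (Ω : Finset (Balaban1983to89.Site P 0)) {x : Balaban1983to89.Site P 0} (hx : x ∈ Ω)
    {z : Balaban1983to89.Site P 0} (hz : z ∉ Ω) (m : ℕ) :
    (((1 : Matrix (Balaban1983to89.Site P 0) (Balaban1983to89.Site P 0) ℝ) - (8 * (P.d : ℝ))⁻¹ • lapN Ω) ^ m) z x = 0 := by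
  induction m with
  | zero =>
      rw [pow_zero, Matrix.one_apply, if_neg]
      intro h
      rw [h] at hz
      exact hz hx
  | succ m ih =>
      rw [pow_succ', Matrix.mul_apply]
      simp_rw [walk_apply_of_not_mem Ω hz]
      rw [Finset.sum_eq_single z (fun w _ hw => by rw [if_neg (Ne.symm hw), zero_mul]) (fun h => absurd (mem_univ z) h),
        if_pos rfl, one_mul, ih]

end Walk

/-! ## §4 The tilted walk `g_m(y) = e^{ψ(y)−ψ(x)}P^m(y,x)`: `ℓ¹` growth, Davies step, normalised Nash–Davies step -/

section Tilt

open Literature.MathematicalPhysics.QuantumFieldTheory.Balaban1983to89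
open BIJ88Sect3Statements (starB mem_starB)
open BIJ88NeumannNoZeroModesTorus (IsBlockUnion)
open BIJ88FreeNeumannLaplacianRegion
open BIJ88BlockUnionNash (nash_blockUnion)

variable {P : Params}

/-- kernel: **the recursion of the tilted walk**, `g_{m+1}(y) = Σ_z e^{ψ(y)−ψ(z)}P(y,z)g_m(z)`. [cite: Balaban1983RegularityDecay, (2.12) p.577] -/
theorem tilt_succ (Ω : Finset (Balaban1983to89.Site P 0)) (ψ : Balaban1983to89.Site P 0 → ℝ) (x : Balaban1983to89.Site P 0) (m : ℕ)
    (y : Balaban1983to89.Site P 0) :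
    Real.exp (ψ y - ψ x) * (((1 : Matrix (Balaban1983to89.Site P 0) (Balaban1983to89.Site P 0) ℝ) - (8 * (P.d : ℝ))⁻¹ • lapN Ω) ^ (m + 1)) y x =
      ∑ z, Real.exp (ψ y - ψ z) * ((1 : Matrix (Balaban1983to89.Site P 0) (Balaban1983to89.Site P 0) ℝ) - (8 * (P.d : ℝ))⁻¹ • lapN Ω) y z *
        (Real.exp (ψ z - ψ x) * (((1 : Matrix (Balaban1983to89.Site P 0) (Balaban1983to89.Site P 0) ℝ) - (8 * (P.d : ℝ))⁻¹ • lapN Ω) ^ m) z x) := by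
  rw [pow_succ', Matrix.mul_apply, mul_sum]
  refine sum_congr rfl fun z _ => ?_
  have e : Real.exp (ψ y - ψ x) = Real.exp (ψ y - ψ z) * Real.exp (ψ z - ψ x) := by rw [← Real.exp_add]; congr 1; ring
  rw [e]; ring

/-- kernel: `g_0 = δ_x`. [cite: Balaban1983RegularityDecay, (2.12) p.577] -/
theorem tilt_zero (Ω : Finset (Balaban1983to89.Site P 0)) (ψ : Balaban1983to89.Site P 0 → ℝ) (x y : Balaban1983to89.Site P 0) :
    Real.exp (ψ y - ψ x) * (((1 : Matrix (Balaban1983to89.Site P 0) (Balaban1983to89.Site P 0) ℝ) - (8 * (P.d : ℝ))⁻¹ • lapN Ω) ^ 0) y x =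
      if y = x then 1 else 0 := by
  rw [pow_zero, Matrix.one_apply]
  split_ifs with h
  · rw [h, sub_self, Real.exp_zero, mul_one]
  · rw [mul_zero]

/-- **`ℓ¹` GROWTH OF THE TILTED WALK**: `Σ_y g_m(y) ≤ (1 + (8D)⁻¹κ)^m` when the weight is flat across the bonds leaving `Ω` at the sites
of `Ω` and has one-step drift `≤ κ` there (`κ ≥ 0`), for `x ∈ Ω`. [cite: BalabanImbrieJaffe1985, (7.3.2) p.326] -/
theorem tilt_ell1_le (Ω : Finset (Balaban1983to89.Site P 0)) (ψ : Balaban1983to89.Site P 0 → ℝ) {x : Balaban1983to89.Site P 0} (hx : x ∈ Ω)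
    (hflat : ∀ y ∈ Ω, ∀ μ : Fin P.d, ((⟨y, μ⟩ : PBond P 0) ∉ starB Ω → ψ (y.shift μ) = ψ y) ∧
      ((⟨y.unshift μ, μ⟩ : PBond P 0) ∉ starB Ω → ψ (y.unshift μ) = ψ y))
    {κ : ℝ} (hκ0 : 0 ≤ κ)
    (hκ : ∀ y ∈ Ω, ∑ μ : Fin P.d, (Real.exp (ψ (y.shift μ) - ψ y) + Real.exp (ψ (y.unshift μ) - ψ y) - 2) ≤ κ) (m : ℕ) :
    ∑ y, Real.exp (ψ y - ψ x) * (((1 : Matrix (Balaban1983to89.Site P 0) (Balaban1983to89.Site P 0) ℝ) - (8 * (P.d : ℝ))⁻¹ • lapN Ω) ^ m) y x ≤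
      (1 + (8 * (P.d : ℝ))⁻¹ * κ) ^ m := by
  have hD : (1 : ℝ) ≤ P.d := by exact_mod_cast P.hd
  induction m with
  | zero => simp_rw [tilt_zero]; rw [Finset.sum_ite_eq' univ x, if_pos (mem_univ _), pow_zero]
  | succ m ih =>
      have hg : ∀ y, y ∉ Ω → Real.exp (ψ y - ψ x) *
          (((1 : Matrix (Balaban1983to89.Site P 0) (Balaban1983to89.Site P 0) ℝ) - (8 * (P.d : ℝ))⁻¹ • lapN Ω) ^ m) y x = 0 :=
        fun y hy => by rw [walkPow_apply_eq_zero_of_not_mem Ω hx hy, mul_zero]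
      have hg0 : ∀ y, 0 ≤ Real.exp (ψ y - ψ x) *
          (((1 : Matrix (Balaban1983to89.Site P 0) (Balaban1983to89.Site P 0) ℝ) - (8 * (P.d : ℝ))⁻¹ • lapN Ω) ^ m) y x :=
        fun y => mul_nonneg (Real.exp_pos _).le (walkPow_apply_nonneg Ω m y x)
      have h := ell1_step_le Ω ψ hg hg0 hflat hκ
      have hΛ : 0 ≤ 1 + (8 * (P.d : ℝ))⁻¹ * κ := by positivity
      calc ∑ y, Real.exp (ψ y - ψ x) *
            (((1 : Matrix (Balaban1983to89.Site P 0) (Balaban1983to89.Site P 0) ℝ) - (8 * (P.d : ℝ))⁻¹ • lapN Ω) ^ (m + 1)) y x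
          = ∑ y, ∑ z, Real.exp (ψ y - ψ z) *
              ((1 : Matrix (Balaban1983to89.Site P 0) (Balaban1983to89.Site P 0) ℝ) - (8 * (P.d : ℝ))⁻¹ • lapN Ω) y z *
              (Real.exp (ψ z - ψ x) *
                (((1 : Matrix (Balaban1983to89.Site P 0) (Balaban1983to89.Site P 0) ℝ) - (8 * (P.d : ℝ))⁻¹ • lapN Ω) ^ m) z x) := by
            simp_rw [tilt_succ]
        _ ≤ (1 + (8 * (P.d : ℝ))⁻¹ * κ) * ∑ z, Real.exp (ψ z - ψ x) *
              (((1 : Matrix (Balaban1983to89.Site P 0) (Balaban1983to89.Site P 0) ℝ) - (8 * (P.d : ℝ))⁻¹ • lapN Ω) ^ m) z x := h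
        _ ≤ (1 + (8 * (P.d : ℝ))⁻¹ * κ) * (1 + (8 * (P.d : ℝ))⁻¹ * κ) ^ m := mul_le_mul_of_nonneg_left ih hΛ
        _ = (1 + (8 * (P.d : ℝ))⁻¹ * κ) ^ (m + 1) := by ring

/-- **THE DAVIES STEP FOR THE TILTED WALK**: `‖g_{m+1}‖² ≤ (1+τ²)‖g_m‖² − (8D)⁻¹E_Ω(g_m)` when `|Δ_bψ| ≤ τ ≤ 1` on `Ω*`.
[cite: Balaban1983RegularityDecay, (2.44) p.584] -/
theorem tilt_sq_succ_le (Ω : Finset (Balaban1983to89.Site P 0)) {ψ : Balaban1983to89.Site P 0 → ℝ} {τ : ℝ} (hτ : τ ≤ 1)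
    (hψ : ∀ b ∈ starB Ω, |ψ b.tgt - ψ b.src| ≤ τ) (x : Balaban1983to89.Site P 0) (m : ℕ) :
    ∑ y, (Real.exp (ψ y - ψ x) *
        (((1 : Matrix (Balaban1983to89.Site P 0) (Balaban1983to89.Site P 0) ℝ) - (8 * (P.d : ℝ))⁻¹ • lapN Ω) ^ (m + 1)) y x) ^ 2 ≤
      (1 + τ ^ 2) * ∑ y, (Real.exp (ψ y - ψ x) *
          (((1 : Matrix (Balaban1983to89.Site P 0) (Balaban1983to89.Site P 0) ℝ) - (8 * (P.d : ℝ))⁻¹ • lapN Ω) ^ m) y x) ^ 2 -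
        (8 * (P.d : ℝ))⁻¹ * ∑ b ∈ starB Ω,
          (Real.exp (ψ b.tgt - ψ x) *
              (((1 : Matrix (Balaban1983to89.Site P 0) (Balaban1983to89.Site P 0) ℝ) - (8 * (P.d : ℝ))⁻¹ • lapN Ω) ^ m) b.tgt x -
            Real.exp (ψ b.src - ψ x) *
              (((1 : Matrix (Balaban1983to89.Site P 0) (Balaban1983to89.Site P 0) ℝ) - (8 * (P.d : ℝ))⁻¹ • lapN Ω) ^ m) b.src x) ^ 2 := by
  simp_rw [tilt_succ]
  exact davies_step Ω hτ hψ (fun z => Real.exp (ψ z - ψ x) *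
    (((1 : Matrix (Balaban1983to89.Site P 0) (Balaban1983to89.Site P 0) ℝ) - (8 * (P.d : ℝ))⁻¹ • lapN Ω) ^ m) z x)

/-- **THE NORMALISED NASH–DAVIES STEP ON A `k`-BLOCK UNION.**  With `Λ = 1 + (8D)⁻¹κ`, `Θ = (1+τ²)Λ² ≤ 4`, `u_m = ‖g_m‖²` and
`ũ_m = u_m/Θ^m`, for every scale `j ≤ k`:  `ũ_{m+1} ≤ ũ_m − (16DL^{2j})⁻¹(ũ_m − L^{−jD})⁺`.
[cite: Balaban1983RegularityDecay, (2.44) p.584] -/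
theorem tilt_normalized_step {j k : ℕ} (hk : k ≤ P.m + P.K) (hjk : j ≤ k) {Ω : Finset (Balaban1983to89.Site P 0)} (hΩ : IsBlockUnion k Ω)
    {ψ : Balaban1983to89.Site P 0 → ℝ} {τ κ : ℝ} (hτ : τ ≤ 1) (hψ : ∀ b ∈ starB Ω, |ψ b.tgt - ψ b.src| ≤ τ)
    {x : Balaban1983to89.Site P 0} (hx : x ∈ Ω) (hκ0 : 0 ≤ κ)
    (hflat : ∀ y ∈ Ω, ∀ μ : Fin P.d, ((⟨y, μ⟩ : PBond P 0) ∉ starB Ω → ψ (y.shift μ) = ψ y) ∧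
      ((⟨y.unshift μ, μ⟩ : PBond P 0) ∉ starB Ω → ψ (y.unshift μ) = ψ y))
    (hκ : ∀ y ∈ Ω, ∑ μ : Fin P.d, (Real.exp (ψ (y.shift μ) - ψ y) + Real.exp (ψ (y.unshift μ) - ψ y) - 2) ≤ κ)
    (hΘ4 : (1 + τ ^ 2) * (1 + (8 * (P.d : ℝ))⁻¹ * κ) ^ 2 ≤ 4) (m : ℕ) :
    (∑ y, (Real.exp (ψ y - ψ x) *
        (((1 : Matrix (Balaban1983to89.Site P 0) (Balaban1983to89.Site P 0) ℝ) - (8 * (P.d : ℝ))⁻¹ • lapN Ω) ^ (m + 1)) y x) ^ 2) /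
        ((1 + τ ^ 2) * (1 + (8 * (P.d : ℝ))⁻¹ * κ) ^ 2) ^ (m + 1) ≤
      (∑ y, (Real.exp (ψ y - ψ x) *
          (((1 : Matrix (Balaban1983to89.Site P 0) (Balaban1983to89.Site P 0) ℝ) - (8 * (P.d : ℝ))⁻¹ • lapN Ω) ^ m) y x) ^ 2) /
          ((1 + τ ^ 2) * (1 + (8 * (P.d : ℝ))⁻¹ * κ) ^ 2) ^ m -
        (((16 * P.d : ℕ) : ℝ) * ((P.L : ℝ) ^ j) ^ 2)⁻¹ *
          max ((∑ y, (Real.exp (ψ y - ψ x) *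
            (((1 : Matrix (Balaban1983to89.Site P 0) (Balaban1983to89.Site P 0) ℝ) - (8 * (P.d : ℝ))⁻¹ • lapN Ω) ^ m) y x) ^ 2) /
            ((1 + τ ^ 2) * (1 + (8 * (P.d : ℝ))⁻¹ * κ) ^ 2) ^ m - (((P.L : ℝ) ^ j) ^ P.d)⁻¹) 0 := by
  have hD : (1 : ℝ) ≤ P.d := by exact_mod_cast P.hd
  have hDpos : (0 : ℝ) < P.d := by linarith
  have hLpos : (0 : ℝ) < P.L := by exact_mod_cast P.L_pos
  have hnj : (0 : ℝ) < (P.L : ℝ) ^ j := pow_pos hLpos j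
  set Pw : Matrix (Balaban1983to89.Site P 0) (Balaban1983to89.Site P 0) ℝ :=
    (1 : Matrix (Balaban1983to89.Site P 0) (Balaban1983to89.Site P 0) ℝ) - (8 * (P.d : ℝ))⁻¹ • lapN Ω with hPw
  set g : Balaban1983to89.Site P 0 → ℝ := fun y => Real.exp (ψ y - ψ x) * (Pw ^ m) y x with hgdef
  set Λ : ℝ := 1 + (8 * (P.d : ℝ))⁻¹ * κ with hΛ
  set Θ : ℝ := (1 + τ ^ 2) * Λ ^ 2 with hΘ
  have hθκ : 0 ≤ (8 * (P.d : ℝ))⁻¹ * κ := by positivity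
  have hΛ1 : 1 ≤ Λ := by rw [hΛ]; linarith
  have hΘ1 : 1 ≤ Θ := by
    rw [hΘ]; have h1 : 1 ≤ Λ ^ 2 := one_le_pow₀ hΛ1; nlinarith [sq_nonneg τ]
  have hΘpos : 0 < Θ := by linarith
  have hg : ∀ y, y ∉ Ω → g y = 0 := fun y hy => by
    simp only [hgdef]; rw [walkPow_apply_eq_zero_of_not_mem Ω hx hy, mul_zero]
  have hg0 : ∀ y, 0 ≤ g y := fun y => mul_nonneg (Real.exp_pos _).le (walkPow_apply_nonneg Ω m y x)
  -- the three inputs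
  have hdav := tilt_sq_succ_le Ω hτ hψ x m
  have hnash := nash_blockUnion hk hjk hΩ hg
  have hell1 := tilt_ell1_le Ω ψ hx hflat hκ0 hκ m
  have habs : ∑ y, |g y| = ∑ y, g y := sum_congr rfl fun y _ => abs_of_nonneg (hg0 y)
  rw [habs] at hnash
  have ha2 : (∑ y, g y) ^ 2 ≤ Θ ^ m := by
    have h1 : (∑ y, g y) ^ 2 ≤ (Λ ^ m) ^ 2 := pow_le_pow_left₀ (sum_nonneg fun y _ => hg0 y) hell1 2
    have h2 : (Λ ^ m) ^ 2 = (Λ ^ 2) ^ m := by ring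
    have h3 : (Λ ^ 2) ^ m ≤ Θ ^ m := pow_le_pow_left₀ (sq_nonneg _) (by rw [hΘ]; nlinarith [sq_nonneg τ, sq_nonneg Λ]) m
    linarith
  have hE : 0 ≤ ∑ b ∈ starB Ω, (g b.tgt - g b.src) ^ 2 := sum_nonneg fun b _ => sq_nonneg _
  have hcast : (((16 * P.d : ℕ) : ℝ) * ((P.L : ℝ) ^ j) ^ 2)⁻¹ = (16 * (P.d : ℝ) * ((P.L : ℝ) ^ j) ^ 2)⁻¹ := by push_cast; ring
  rw [hcast, pow_succ]
  exact normalized_step P.d hDpos hnj (sum_nonneg fun y _ => sq_nonneg _) hdav hnash hE (pow_pos hΘpos m) ha2 hΘ hΛ1 hΘ4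

end Tilt

/-! ## §5 The Neumann series `R = α⁻¹Σ_{m<N}(qP)^m + R(qP)^N` of `R = (n²(−Δ^N_Ω) + 1)⁻¹` -/

section Series

open Literature.MathematicalPhysics.QuantumFieldTheory.Balaban1983to89
open BIJ88FreeNeumannLaplacianRegion

variable {P : Params}

/-- kernel: `n²(−Δ^N_Ω) + 1 = α(1 − qP)` with `α = 8Dn² + 1`, `q = 8Dn²/α`. [cite: Balaban1983RegularityDecay, (2.12) p.577] -/
theorem massOp_eq_smul (Ω : Finset (Balaban1983to89.Site P 0)) {n2 : ℝ} (hn2 : 0 ≤ n2) :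
    n2 • lapN Ω + 1 = (8 * (P.d : ℝ) * n2 + 1) •
      ((1 : Matrix (Balaban1983to89.Site P 0) (Balaban1983to89.Site P 0) ℝ) - (8 * (P.d : ℝ) * n2 / (8 * (P.d : ℝ) * n2 + 1)) •
        ((1 : Matrix (Balaban1983to89.Site P 0) (Balaban1983to89.Site P 0) ℝ) - (8 * (P.d : ℝ))⁻¹ • lapN Ω)) := by
  have hD : (1 : ℝ) ≤ P.d := by exact_mod_cast P.hd
  have hDne : (P.d : ℝ) ≠ 0 := by positivity
  have hα : (8 * (P.d : ℝ) * n2 + 1) ≠ 0 := by positivity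
  ext i j
  simp only [Matrix.add_apply, Matrix.smul_apply, Matrix.sub_apply, Matrix.one_apply, smul_eq_mul]
  split_ifs <;> field_simp <;> ring

/-- **THE TRUNCATED NEUMANN SERIES OF THE FREE REGION RESOLVENT** (for the reflecting walk of the region, the analogue of [6]'s random walk
representation (2.12) *"G_k(Ω,A) = G_0(I − R)^{−1} = Σ_{n=0}^∞ G_0R^n"*): `R(y,x) = α⁻¹Σ_{i<N} q^iP^i(y,x) + (R(qP)^N)(y,x)`.
[cite: Balaban1983RegularityDecay, (2.12) p.577] -/
theorem inv_massOp_apply_eq_series (Ω : Finset (Balaban1983to89.Site P 0)) {n2 : ℝ} (hn2 : 0 ≤ n2) (N : ℕ) (y x : Balaban1983to89.Site P 0) :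
    (n2 • lapN Ω + 1)⁻¹ y x =
      (8 * (P.d : ℝ) * n2 + 1)⁻¹ * ∑ i ∈ range N, (8 * (P.d : ℝ) * n2 / (8 * (P.d : ℝ) * n2 + 1)) ^ i *
          (((1 : Matrix (Balaban1983to89.Site P 0) (Balaban1983to89.Site P 0) ℝ) - (8 * (P.d : ℝ))⁻¹ • lapN Ω) ^ i) y x +
        ((n2 • lapN Ω + 1)⁻¹ * ((8 * (P.d : ℝ) * n2 / (8 * (P.d : ℝ) * n2 + 1)) •
          ((1 : Matrix (Balaban1983to89.Site P 0) (Balaban1983to89.Site P 0) ℝ) - (8 * (P.d : ℝ))⁻¹ • lapN Ω)) ^ N) y x := by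
  have hD : (1 : ℝ) ≤ P.d := by exact_mod_cast P.hd
  have hαpos : 0 < 8 * (P.d : ℝ) * n2 + 1 := by positivity
  set α : ℝ := 8 * (P.d : ℝ) * n2 + 1 with hα
  set Q : Matrix (Balaban1983to89.Site P 0) (Balaban1983to89.Site P 0) ℝ := (8 * (P.d : ℝ) * n2 / α) •
    ((1 : Matrix (Balaban1983to89.Site P 0) (Balaban1983to89.Site P 0) ℝ) - (8 * (P.d : ℝ))⁻¹ • lapN Ω) with hQ
  set M : Matrix (Balaban1983to89.Site P 0) (Balaban1983to89.Site P 0) ℝ := n2 • lapN Ω + 1 with hM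
  have hMQ : M = α • (1 - Q) := massOp_eq_smul Ω hn2
  have hgeom : (1 - Q) * ∑ i ∈ range N, Q ^ i = 1 - Q ^ N := mul_neg_geom_sum Q N
  have h1 : M * ∑ i ∈ range N, Q ^ i = α • (1 - Q ^ N) := by rw [hMQ, smul_mul_assoc, hgeom]
  have h2 : ∑ i ∈ range N, Q ^ i = α • M⁻¹ - α • (M⁻¹ * Q ^ N) := by
    have h3 : M⁻¹ * (M * ∑ i ∈ range N, Q ^ i) = ∑ i ∈ range N, Q ^ i := by
      rw [← mul_assoc, hM, inv_mul_massOp hn2 Ω, one_mul]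
    rw [← h3, h1, mul_smul_comm, mul_sub, mul_one, smul_sub]
  have h4 := congr_fun (congr_fun h2 y) x
  simp only [Matrix.sub_apply, Matrix.smul_apply, smul_eq_mul, Matrix.sum_apply] at h4
  have h5 : ∀ i, (Q ^ i) y x = (8 * (P.d : ℝ) * n2 / α) ^ i *
      (((1 : Matrix (Balaban1983to89.Site P 0) (Balaban1983to89.Site P 0) ℝ) - (8 * (P.d : ℝ))⁻¹ • lapN Ω) ^ i) y x := fun i => by
    rw [hQ, smul_pow, Matrix.smul_apply, smul_eq_mul]
  simp_rw [h5] at h4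
  rw [h4]
  field_simp
  ring

/-- kernel: **the remainder of the series is between `0` and `q^N`** (`R ≥ 0` with row sums `1`, `0 ≤ P^N ≤ 1`).
[cite: Balaban1983RegularityDecay, (2.12) p.577] -/
theorem rem_apply_bounds (Ω : Finset (Balaban1983to89.Site P 0)) {n2 : ℝ} (hn2 : 0 ≤ n2) {q : ℝ} (hq : 0 ≤ q) (N : ℕ)
    (y x : Balaban1983to89.Site P 0) :
    0 ≤ ((n2 • lapN Ω + 1)⁻¹ * (q • ((1 : Matrix (Balaban1983to89.Site P 0) (Balaban1983to89.Site P 0) ℝ) -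
      (8 * (P.d : ℝ))⁻¹ • lapN Ω)) ^ N) y x ∧
    ((n2 • lapN Ω + 1)⁻¹ * (q • ((1 : Matrix (Balaban1983to89.Site P 0) (Balaban1983to89.Site P 0) ℝ) -
      (8 * (P.d : ℝ))⁻¹ • lapN Ω)) ^ N) y x ≤ q ^ N := by
  rw [smul_pow, Matrix.mul_smul, Matrix.smul_apply, smul_eq_mul, Matrix.mul_apply]
  refine ⟨mul_nonneg (pow_nonneg hq N) (sum_nonneg fun z _ =>
    mul_nonneg (inv_massOp_apply_nonneg hn2 Ω y z) (walkPow_apply_nonneg Ω N z x)), ?_⟩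
  calc q ^ N * ∑ z, (n2 • lapN Ω + 1)⁻¹ y z *
        (((1 : Matrix (Balaban1983to89.Site P 0) (Balaban1983to89.Site P 0) ℝ) - (8 * (P.d : ℝ))⁻¹ • lapN Ω) ^ N) z x
      ≤ q ^ N * ∑ z, (n2 • lapN Ω + 1)⁻¹ y z * 1 :=
        mul_le_mul_of_nonneg_left (sum_le_sum fun z _ =>
          mul_le_mul_of_nonneg_left (walkPow_apply_le_one Ω N z x) (inv_massOp_apply_nonneg hn2 Ω y z)) (pow_nonneg hq N)
    _ = q ^ N := by simp_rw [mul_one]; rw [sum_inv_massOp_apply hn2 Ω y, mul_one]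

end Series

/-! ## §6 The tilted column of `R_Ω = (L^{2k}(−Δ^N_Ω) + 1)⁻¹`: `Σ_y(e^{ψ(y)−ψ(x)}R_Ω(y,x))² ≤ K/L^{kD}` -/

section Main

open Literature.MathematicalPhysics.QuantumFieldTheory.Balaban1983to89
open BIJ88Sect3Statements (starB mem_starB)
open BIJ88NeumannNoZeroModesTorus (IsBlockUnion)
open BIJ88FreeNeumannLaplacianRegion

/-- **THE TILTED COLUMN OF THE FREE REGION RESOLVENT, `k`-UNIFORMLY ON EVERY `k`-BLOCK UNION (explicit constants).**  For `D = P.d ≤ 3`,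
`k ≤ m + K`, `Ω` a union of `k`-blocks of the fine torus, `x ∈ Ω`, `0 ≤ t ≤ 1/(100D)` and ANY weight `ψ` with `|Δ_bψ| ≤ t/L^k` on `Ω*`,
flat across the bonds leaving `Ω` at the sites of `Ω`, and one-step drift `≤ D(8t + 2t²)/L^{2k}` at the sites of `Ω`:
`Σ_y (e^{ψ(y)−ψ(x)}R_Ω(y,x))² ≤ K₂²/L^{kD}`, `R_Ω = (L^{2k}(−Δ^N_Ω) + 1)⁻¹`, with `K₂ = K₁/(8D) + 2√2`,
`K₁ = W(1 + √2L²/(√(L^{4−D}) − 1))`,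
`W = 64DL^D`.  ([6] (1.10)'s free input `|G_k(Ω,0)(x,y)| ≤ c₀e^{−δ₀|x−y|}` in squared-row form, for GENERAL block unions.)
[cite: Balaban1983RegularityDecay, (1.10) p.573] -/
theorem tilted_col_sq_le_explicit (P : Params) (hd3 : P.d ≤ 3) {k : ℕ} (hk : k ≤ P.m + P.K)
    {Ω : Finset (Balaban1983to89.Site P 0)} (hΩ : IsBlockUnion k Ω) {t : ℝ} (ht0 : 0 ≤ t) (ht1 : t ≤ 1 / (100 * (P.d : ℝ)))
    (ψ : Balaban1983to89.Site P 0 → ℝ) {x : Balaban1983to89.Site P 0} (hx : x ∈ Ω)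
    (hψ : ∀ b ∈ starB Ω, |ψ b.tgt - ψ b.src| ≤ t / (P.L : ℝ) ^ k)
    (hflat : ∀ y ∈ Ω, ∀ μ : Fin P.d, ((⟨y, μ⟩ : PBond P 0) ∉ starB Ω → ψ (y.shift μ) = ψ y) ∧
      ((⟨y.unshift μ, μ⟩ : PBond P 0) ∉ starB Ω → ψ (y.unshift μ) = ψ y))
    (hκ : ∀ y ∈ Ω, ∑ μ : Fin P.d, (Real.exp (ψ (y.shift μ) - ψ y) + Real.exp (ψ (y.unshift μ) - ψ y) - 2) ≤
      P.d * ((8 * t + 2 * t ^ 2) / ((P.L : ℝ) ^ k) ^ 2)) :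
    ∑ y, (Real.exp (ψ y - ψ x) * ((((P.L : ℝ) ^ k) ^ 2) • lapN Ω + 1)⁻¹ y x) ^ 2 ≤
      ((((4 * (16 * P.d) * P.L ^ P.d : ℕ)) : ℝ) * (1 + Real.sqrt 2 * (P.L : ℝ) ^ 2 / (Real.sqrt ((P.L : ℝ) ^ (4 - P.d)) - 1)) /
          (8 * (P.d : ℝ)) + 2 * Real.sqrt 2) ^ 2 / ((P.L : ℝ) ^ k) ^ P.d := by
  -- basic facts
  have hD : (1 : ℝ) ≤ P.d := by exact_mod_cast P.hd
  have hDpos : (0 : ℝ) < P.d := by linarith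
  have hL3 : 3 ≤ P.L := by obtain ⟨⟨r, hr⟩, h1⟩ := P.hL; omega
  have hL2 : 2 ≤ P.L := by omega
  have hLr : (2 : ℝ) ≤ P.L := by exact_mod_cast hL2
  have hLpos : (0 : ℝ) < P.L := by linarith
  have hn1' : (1 : ℝ) ≤ (P.L : ℝ) ^ k := one_le_pow₀ (by linarith)
  set n : ℝ := (P.L : ℝ) ^ k with hn
  clear_value n
  have hn1 : 1 ≤ n := hn ▸ hn1'
  have hnpos : 0 < n := by linarith
  have hn2 : (0 : ℝ) ≤ n ^ 2 := sq_nonneg n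
  have hnD : 0 < n ^ P.d := pow_pos hnpos _
  have ht100 : t ≤ 1 / 100 := ht1.trans (one_div_le_one_div_of_le (by norm_num) (by nlinarith))
  -- the iteration parameters (opaque names with defining equations)
  set τ : ℝ := t / n with hτ
  set κ : ℝ := P.d * ((8 * t + 2 * t ^ 2) / n ^ 2) with hκdef
  clear_value τ κ
  have hτ1 : τ ≤ 1 := by rw [hτ, div_le_one hnpos]; linarith
  have hκ0 : 0 ≤ κ := by rw [hκdef]; positivity
  have hθκ : 0 ≤ (8 * (P.d : ℝ))⁻¹ * κ := by positivity
  set Λ : ℝ := 1 + (8 * (P.d : ℝ))⁻¹ * κ with hΛ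
  set Θ : ℝ := (1 + τ ^ 2) * Λ ^ 2 with hΘ
  clear_value Λ Θ
  have hΛ1 : 1 ≤ Λ := by rw [hΛ]; linarith
  have hΘ1 : 1 ≤ Θ := by
    rw [hΘ]; have h1 : 1 ≤ Λ ^ 2 := one_le_pow₀ hΛ1; nlinarith [sq_nonneg τ]
  have hΘpos : 0 < Θ := by linarith
  have hΘle : Θ ≤ 1 + (8 * (P.d : ℝ) * n ^ 2)⁻¹ := by
    rw [hΘ, hΛ, hκdef, hτ]; exact theta_le hD hn1 ht0 ht1
  have hΘ4 : Θ ≤ 4 := hΘle.trans (by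
    have : (8 * (P.d : ℝ) * n ^ 2)⁻¹ ≤ 1 := inv_le_one_of_one_le₀ (by nlinarith); linarith)
  have hΘ4' : (1 + τ ^ 2) * (1 + (8 * (P.d : ℝ))⁻¹ * κ) ^ 2 ≤ 4 := by rw [← hΛ, ← hΘ]; exact hΘ4
  -- the normalised squared norms `v_m = ‖g_m‖²/Θ^m` of the tilted walk
  set v : ℕ → ℝ := fun m => (∑ y, (Real.exp (ψ y - ψ x) *
    (((1 : Matrix (Balaban1983to89.Site P 0) (Balaban1983to89.Site P 0) ℝ) - (8 * (P.d : ℝ))⁻¹ • lapN Ω) ^ m) y x) ^ 2) / Θ ^ m with hv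
  clear_value v
  have hv0 : v 0 = 1 := by
    rw [hv]
    dsimp only
    simp_rw [tilt_zero]
    rw [pow_zero, div_one]
    have e : ∀ y : Balaban1983to89.Site P 0, ((if y = x then (1 : ℝ) else 0) ^ 2) = if y = x then 1 else 0 := fun y => by
      split_ifs <;> norm_num
    simp_rw [e]
    rw [Finset.sum_ite_eq' univ x, if_pos (mem_univ _)]
  have hvnn : ∀ m, 0 ≤ v m := fun m => by
    rw [hv]; exact div_nonneg (sum_nonneg fun y _ => sq_nonneg _) (pow_pos hΘpos m).le
  have hvstep : ∀ j ≤ k, ∀ m, v (m + 1) ≤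
      v m - (((16 * P.d : ℕ) : ℝ) * ((P.L : ℝ) ^ j) ^ 2)⁻¹ * max (v m - (((P.L : ℝ) ^ j) ^ P.d)⁻¹) 0 := by
    intro j hj m
    have h := tilt_normalized_step hk hj hΩ hτ1 hψ hx hκ0 hflat hκ hΘ4' m
    rw [hv]
    dsimp only
    rw [hΘ, hΛ]
    exact h
  -- the `L`-adic descent and the monotonicity
  have hdesc := descent P.L P.d (16 * P.d) k hL2 (by have := P.hd; omega) v hv0.le hvstep
  have hv1 : ∀ m, v m ≤ 1 := fun m => by
    have hc : (0 : ℝ) ≤ (((16 * P.d : ℕ) : ℝ) * ((P.L : ℝ) ^ 0) ^ 2)⁻¹ := by positivity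
    have h := le_init_of_step v hc (hvstep 0 (Nat.zero_le k)) m
    rw [hv0] at h; exact h
  set W : ℕ := 4 * (16 * P.d) * P.L ^ P.d with hWdef
  have hdesc' : ∀ j ≤ k, ∀ m : ℕ, W * P.L ^ (2 * j) ≤ m → v m ≤ 2 * (((P.L : ℝ) ^ j) ^ P.d)⁻¹ :=
    fun j hj m hm => hdesc j hj m hm
  -- the series parameters
  have h8 : 8 ≤ 8 * (P.d : ℝ) * n ^ 2 := by nlinarith
  set α : ℝ := 8 * (P.d : ℝ) * n ^ 2 + 1 with hα
  clear_value α
  have hαpos : 0 < α := by rw [hα]; linarith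
  have hαne : α ≠ 0 := hαpos.ne'
  have hα1 : 1 < α := by rw [hα]; linarith
  have hα1' : α - 1 ≠ 0 := sub_ne_zero.2 hα1.ne'
  have e0 : 8 * (P.d : ℝ) * n ^ 2 = α - 1 := by rw [hα]; ring
  set q : ℝ := 8 * (P.d : ℝ) * n ^ 2 / α with hq
  clear_value q
  have hq' : q = 1 - α⁻¹ := by rw [hq, e0]; field_simp
  have hq0 : 0 ≤ q := by rw [hq, e0]; exact div_nonneg (by linarith) hαpos.le
  have hq1 : q < 1 := by rw [hq']; have := inv_pos.2 hαpos; linarith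
  set r : ℝ := 1 - (2 * α)⁻¹ with hr
  clear_value r
  have h2α : 0 < (2 * α)⁻¹ := by positivity
  have hr0 : 0 ≤ r := by
    rw [hr]; have : (2 * α)⁻¹ ≤ 1 := inv_le_one_of_one_le₀ (by linarith); linarith
  have hr1 : r < 1 := by rw [hr]; linarith
  have h1r : (1 - r)⁻¹ = 2 * α := by rw [hr, sub_sub_cancel, inv_inv]
  have hq2Θ : q ^ 2 * Θ ≤ r ^ 2 := by
    have hΘ' : Θ ≤ α / (α - 1) := by
      have e : α / (α - 1) = 1 + (8 * (P.d : ℝ) * n ^ 2)⁻¹ := by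
        rw [e0]; field_simp; ring
      rw [e]; exact hΘle
    have e1 : q ^ 2 * (α / (α - 1)) = 1 - α⁻¹ := by
      rw [hq']
      field_simp
    calc q ^ 2 * Θ ≤ q ^ 2 * (α / (α - 1)) := mul_le_mul_of_nonneg_left hΘ' (sq_nonneg q)
      _ = 1 - α⁻¹ := e1
      _ ≤ r ^ 2 := by rw [hr]; exact one_sub_inv_le_sq α
  -- termwise: `q^i‖g_i‖ ≤ r^i√v_i`
  have hterm : ∀ i, q ^ i * Real.sqrt (∑ y, (Real.exp (ψ y - ψ x) *
      (((1 : Matrix (Balaban1983to89.Site P 0) (Balaban1983to89.Site P 0) ℝ) - (8 * (P.d : ℝ))⁻¹ • lapN Ω) ^ i) y x) ^ 2) ≤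
      r ^ i * Real.sqrt (v i) := by
    intro i
    have eu : ∑ y, (Real.exp (ψ y - ψ x) *
        (((1 : Matrix (Balaban1983to89.Site P 0) (Balaban1983to89.Site P 0) ℝ) - (8 * (P.d : ℝ))⁻¹ • lapN Ω) ^ i) y x) ^ 2 =
        Θ ^ i * v i := by
      rw [hv]; dsimp only; rw [mul_div_cancel₀ _ (pow_pos hΘpos i).ne']
    rw [eu]
    exact geom_sqrt_le i hq0 hr0 hΘpos.le (hvnn i) hq2Θ
  -- the scale sum, uniformly in `N`
  have hS : ∀ N, ∑ i ∈ range N, r ^ i * Real.sqrt (v i) ≤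
      ((W : ℝ) * (1 + Real.sqrt 2 * (P.L : ℝ) ^ 2 / (Real.sqrt ((P.L : ℝ) ^ (4 - P.d)) - 1))) * (n ^ 2 / Real.sqrt (n ^ P.d)) +
        2 * α * (Real.sqrt 2 / Real.sqrt (n ^ P.d)) := by
    intro N
    have h1 := sum_geom_sqrt_le P.L P.d W k v hv1 hdesc' hr0 hr1 N
    have h2 := scaleSum_le P.L P.d W k hL2 hd3
    rw [h1r, ← hn] at h1
    rw [← hn] at h2
    linarith
  -- the column decomposition at every truncation order `N`, Minkowski, the remainder
  have hCψ0 : 0 ≤ ∑ z, Real.exp (ψ z - ψ x) := sum_nonneg fun z _ => (Real.exp_pos _).le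
  have hCψ_ge : ∀ y, Real.exp (ψ y - ψ x) ≤ ∑ z, Real.exp (ψ z - ψ x) := fun y =>
    single_le_sum (f := fun z => Real.exp (ψ z - ψ x)) (fun z _ => (Real.exp_pos _).le) (mem_univ y)
  set Cψ : ℝ := ∑ z, Real.exp (ψ z - ψ x) with hCψ
  clear_value Cψ
  have hmain : ∀ N : ℕ, Real.sqrt (∑ y, (Real.exp (ψ y - ψ x) * ((n ^ 2) • lapN Ω + 1)⁻¹ y x) ^ 2) ≤
      α⁻¹ * (((W : ℝ) * (1 + Real.sqrt 2 * (P.L : ℝ) ^ 2 / (Real.sqrt ((P.L : ℝ) ^ (4 - P.d)) - 1))) * (n ^ 2 / Real.sqrt (n ^ P.d)) +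
        2 * α * (Real.sqrt 2 / Real.sqrt (n ^ P.d))) +
        Real.sqrt ((univ : Finset (Balaban1983to89.Site P 0)).card) * (Cψ * q ^ N) := by
    intro N
    have hdec : ∀ y, Real.exp (ψ y - ψ x) * ((n ^ 2) • lapN Ω + 1)⁻¹ y x =
        (∑ i ∈ range N, (α⁻¹ * q ^ i) * (Real.exp (ψ y - ψ x) *
          (((1 : Matrix (Balaban1983to89.Site P 0) (Balaban1983to89.Site P 0) ℝ) - (8 * (P.d : ℝ))⁻¹ • lapN Ω) ^ i) y x)) +
        Real.exp (ψ y - ψ x) * (((n ^ 2) • lapN Ω + 1)⁻¹ *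
          (q • ((1 : Matrix (Balaban1983to89.Site P 0) (Balaban1983to89.Site P 0) ℝ) - (8 * (P.d : ℝ))⁻¹ • lapN Ω)) ^ N) y x := by
      intro y
      rw [inv_massOp_apply_eq_series Ω hn2 N y x, ← hα, ← hq, mul_add, mul_sum, mul_sum]
      refine congrArg (· + _) (sum_congr rfl fun i _ => by ring)
    have hrem : ∀ y, |Real.exp (ψ y - ψ x) * (((n ^ 2) • lapN Ω + 1)⁻¹ *
        (q • ((1 : Matrix (Balaban1983to89.Site P 0) (Balaban1983to89.Site P 0) ℝ) - (8 * (P.d : ℝ))⁻¹ • lapN Ω)) ^ N) y x| ≤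
        Cψ * q ^ N := by
      intro y
      obtain ⟨h0, h1⟩ := rem_apply_bounds Ω hn2 hq0 N y x
      rw [abs_of_nonneg (mul_nonneg (Real.exp_pos _).le h0)]
      exact mul_le_mul (hCψ_ge y) h1 h0 hCψ0
    have hCq : 0 ≤ Cψ * q ^ N := mul_nonneg hCψ0 (pow_nonneg hq0 N)
    calc Real.sqrt (∑ y, (Real.exp (ψ y - ψ x) * ((n ^ 2) • lapN Ω + 1)⁻¹ y x) ^ 2)
        = Real.sqrt (∑ y, ((∑ i ∈ range N, (α⁻¹ * q ^ i) * (Real.exp (ψ y - ψ x) *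
            (((1 : Matrix (Balaban1983to89.Site P 0) (Balaban1983to89.Site P 0) ℝ) - (8 * (P.d : ℝ))⁻¹ • lapN Ω) ^ i) y x)) +
            Real.exp (ψ y - ψ x) * (((n ^ 2) • lapN Ω + 1)⁻¹ *
              (q • ((1 : Matrix (Balaban1983to89.Site P 0) (Balaban1983to89.Site P 0) ℝ) - (8 * (P.d : ℝ))⁻¹ • lapN Ω)) ^ N) y x) ^ 2) := by
          simp_rw [← hdec]
      _ ≤ Real.sqrt (∑ y, (∑ i ∈ range N, (α⁻¹ * q ^ i) * (Real.exp (ψ y - ψ x) *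
            (((1 : Matrix (Balaban1983to89.Site P 0) (Balaban1983to89.Site P 0) ℝ) - (8 * (P.d : ℝ))⁻¹ • lapN Ω) ^ i) y x)) ^ 2) +
          Real.sqrt (∑ y, (Real.exp (ψ y - ψ x) * (((n ^ 2) • lapN Ω + 1)⁻¹ *
            (q • ((1 : Matrix (Balaban1983to89.Site P 0) (Balaban1983to89.Site P 0) ℝ) - (8 * (P.d : ℝ))⁻¹ • lapN Ω)) ^ N) y x) ^ 2) :=
          sqrt_sum_sq_add_le univ _ _
      _ ≤ (∑ i ∈ range N, Real.sqrt (∑ y, ((α⁻¹ * q ^ i) * (Real.exp (ψ y - ψ x) *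
            (((1 : Matrix (Balaban1983to89.Site P 0) (Balaban1983to89.Site P 0) ℝ) - (8 * (P.d : ℝ))⁻¹ • lapN Ω) ^ i) y x)) ^ 2)) +
          Real.sqrt ((univ : Finset (Balaban1983to89.Site P 0)).card) * (Cψ * q ^ N) :=
          add_le_add (sqrt_sum_sq_sum_le univ (range N) _) (sqrt_sum_sq_le_of_abs_le univ _ hCq fun y _ => hrem y)
      _ = α⁻¹ * ∑ i ∈ range N, q ^ i * Real.sqrt (∑ y, (Real.exp (ψ y - ψ x) *
            (((1 : Matrix (Balaban1983to89.Site P 0) (Balaban1983to89.Site P 0) ℝ) - (8 * (P.d : ℝ))⁻¹ • lapN Ω) ^ i) y x) ^ 2) +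
          Real.sqrt ((univ : Finset (Balaban1983to89.Site P 0)).card) * (Cψ * q ^ N) := by
          rw [mul_sum]
          congr 1
          refine sum_congr rfl fun i _ => ?_
          have hci : (0 : ℝ) ≤ α⁻¹ * q ^ i := mul_nonneg (inv_pos.2 hαpos).le (pow_nonneg hq0 i)
          rw [sqrt_sum_sq_mul univ _ hci, mul_assoc]
      _ ≤ α⁻¹ * ∑ i ∈ range N, r ^ i * Real.sqrt (v i) + Real.sqrt ((univ : Finset (Balaban1983to89.Site P 0)).card) * (Cψ * q ^ N) :=
          add_le_add (mul_le_mul_of_nonneg_left (sum_le_sum fun i _ => hterm i) (inv_pos.2 hαpos).le) le_rfl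
      _ ≤ _ := add_le_add (mul_le_mul_of_nonneg_left (hS N) (inv_pos.2 hαpos).le) le_rfl
  -- `N → ∞`
  have hlim : Real.sqrt (∑ y, (Real.exp (ψ y - ψ x) * ((n ^ 2) • lapN Ω + 1)⁻¹ y x) ^ 2) ≤
      α⁻¹ * (((W : ℝ) * (1 + Real.sqrt 2 * (P.L : ℝ) ^ 2 / (Real.sqrt ((P.L : ℝ) ^ (4 - P.d)) - 1))) * (n ^ 2 / Real.sqrt (n ^ P.d)) +
        2 * α * (Real.sqrt 2 / Real.sqrt (n ^ P.d))) := by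
    refine le_of_forall_pos_le_add fun ε hε => ?_
    have hA0 : 0 ≤ Real.sqrt ((univ : Finset (Balaban1983to89.Site P 0)).card) * Cψ := mul_nonneg (Real.sqrt_nonneg _) hCψ0
    set A : ℝ := Real.sqrt ((univ : Finset (Balaban1983to89.Site P 0)).card) * Cψ with hA
    clear_value A
    have hA1 : 0 < A + 1 := by linarith
    obtain ⟨N, hN⟩ := exists_pow_lt_of_lt_one (div_pos hε hA1) hq1
    have h := hmain N
    have hε' : Real.sqrt ((univ : Finset (Balaban1983to89.Site P 0)).card) * (Cψ * q ^ N) ≤ ε := by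
      rw [← mul_assoc, ← hA]
      calc A * q ^ N ≤ (A + 1) * q ^ N := mul_le_mul_of_nonneg_right (by linarith) (pow_nonneg hq0 N)
        _ ≤ (A + 1) * (ε / (A + 1)) := mul_le_mul_of_nonneg_left hN.le hA1.le
        _ = ε := mul_div_cancel₀ _ hA1.ne'
    linarith
  -- the prefactor: `α⁻¹n² ≤ (8D)⁻¹`, `α⁻¹·2α = 2`
  have hγ1 : 1 < Real.sqrt ((P.L : ℝ) ^ (4 - P.d)) := by
    rw [show (1 : ℝ) = Real.sqrt 1 from Real.sqrt_one.symm]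
    refine Real.sqrt_lt_sqrt zero_le_one ?_
    calc (1 : ℝ) < 2 := one_lt_two
      _ ≤ P.L := hLr
      _ = (P.L : ℝ) ^ 1 := (pow_one _).symm
      _ ≤ (P.L : ℝ) ^ (4 - P.d) := pow_le_pow_right₀ (by linarith) (by omega)
  have hγ0 : 0 < Real.sqrt ((P.L : ℝ) ^ (4 - P.d)) - 1 := by linarith
  have hK₁ : 0 ≤ (W : ℝ) * (1 + Real.sqrt 2 * (P.L : ℝ) ^ 2 / (Real.sqrt ((P.L : ℝ) ^ (4 - P.d)) - 1)) := by positivity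
  set K₁ : ℝ := (W : ℝ) * (1 + Real.sqrt 2 * (P.L : ℝ) ^ 2 / (Real.sqrt ((P.L : ℝ) ^ (4 - P.d)) - 1)) with hK₁def
  clear_value K₁
  have hsq0 : 0 < Real.sqrt (n ^ P.d) := Real.sqrt_pos.2 hnD
  set S : ℝ := Real.sqrt (n ^ P.d) with hSdef
  clear_value S
  have hαn : α⁻¹ * n ^ 2 ≤ (8 * (P.d : ℝ))⁻¹ := by
    rw [inv_mul_le_iff₀ hαpos, hα]
    rw [show (8 * (P.d : ℝ) * n ^ 2 + 1) * (8 * (P.d : ℝ))⁻¹ = n ^ 2 + (8 * (P.d : ℝ))⁻¹ by field_simp]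
    linarith [inv_pos.2 (show (0 : ℝ) < 8 * P.d by positivity)]
  have hB : α⁻¹ * (K₁ * (n ^ 2 / S) + 2 * α * (Real.sqrt 2 / S)) ≤ (K₁ / (8 * (P.d : ℝ)) + 2 * Real.sqrt 2) / S := by
    have e1 : α⁻¹ * (K₁ * (n ^ 2 / S) + 2 * α * (Real.sqrt 2 / S)) = ((α⁻¹ * n ^ 2) * K₁ + 2 * Real.sqrt 2) / S := by
      field_simp
    rw [e1]
    refine div_le_div_of_nonneg_right ?_ hsq0.le
    rw [div_eq_inv_mul]
    linarith [mul_le_mul_of_nonneg_right hαn hK₁]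
  -- square
  have h0 : 0 ≤ ∑ y, (Real.exp (ψ y - ψ x) * ((n ^ 2) • lapN Ω + 1)⁻¹ y x) ^ 2 := sum_nonneg fun y _ => sq_nonneg _
  have hfin := hlim.trans hB
  have hS2 : S ^ 2 = n ^ P.d := by rw [hSdef, Real.sq_sqrt hnD.le]
  calc ∑ y, (Real.exp (ψ y - ψ x) * ((n ^ 2) • lapN Ω + 1)⁻¹ y x) ^ 2
      = Real.sqrt (∑ y, (Real.exp (ψ y - ψ x) * ((n ^ 2) • lapN Ω + 1)⁻¹ y x) ^ 2) ^ 2 := (Real.sq_sqrt h0).symm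
    _ ≤ ((K₁ / (8 * (P.d : ℝ)) + 2 * Real.sqrt 2) / S) ^ 2 := pow_le_pow_left₀ (Real.sqrt_nonneg _) hfin 2
    _ = _ := by rw [div_pow, hS2, hK₁def]

/-- **THE TILTED COLUMN OF THE FREE REGION RESOLVENT — packaged with constants depending on `(D, L)` only.**  For `D = d + 1 ≤ 3` and
`L = ℓ + 1` there are `t₀, K > 0` such that for every `P` with these `D, L`, every `k ≤ m + K`, every `k`-block union `Ω`, every
`0 ≤ t ≤ t₀`, every weight `ψ` as in `tilted_col_sq_le_explicit` and every `x ∈ Ω`:  `Σ_y (e^{ψ(y)−ψ(x)}R_Ω(y,x))² ≤ K/L^{kD}`.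
[cite: Balaban1983RegularityDecay, (1.10) p.573] -/
theorem tilted_col_sq_le (d ℓ : ℕ) (hd3 : d + 1 ≤ 3) (hℓ : 1 ≤ ℓ) :
    ∃ t₀ K : ℝ, 0 < t₀ ∧ 0 < K ∧ ∀ (P : Params), P.d = d + 1 → P.L = ℓ + 1 →
      ∀ k : ℕ, k ≤ P.m + P.K → ∀ Ω : Finset (Balaban1983to89.Site P 0), IsBlockUnion k Ω →
      ∀ t : ℝ, 0 ≤ t → t ≤ t₀ → ∀ (ψ : Balaban1983to89.Site P 0 → ℝ) (x : Balaban1983to89.Site P 0), x ∈ Ω →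
        (∀ b ∈ starB Ω, |ψ b.tgt - ψ b.src| ≤ t / (P.L : ℝ) ^ k) →
        (∀ y ∈ Ω, ∀ μ : Fin P.d, ((⟨y, μ⟩ : PBond P 0) ∉ starB Ω → ψ (y.shift μ) = ψ y) ∧
          ((⟨y.unshift μ, μ⟩ : PBond P 0) ∉ starB Ω → ψ (y.unshift μ) = ψ y)) →
        (∀ y ∈ Ω, ∑ μ : Fin P.d, (Real.exp (ψ (y.shift μ) - ψ y) + Real.exp (ψ (y.unshift μ) - ψ y) - 2) ≤
          P.d * ((8 * t + 2 * t ^ 2) / ((P.L : ℝ) ^ k) ^ 2)) →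
        ∑ y, (Real.exp (ψ y - ψ x) * ((((P.L : ℝ) ^ k) ^ 2) • lapN Ω + 1)⁻¹ y x) ^ 2 ≤ K / ((P.L : ℝ) ^ k) ^ (d + 1) := by
  have hℓr : (1 : ℝ) ≤ ℓ := by exact_mod_cast hℓ
  have hL2 : (2 : ℝ) ≤ ((ℓ + 1 : ℕ) : ℝ) := by push_cast; linarith
  have hγ1 : 1 < Real.sqrt ((((ℓ + 1 : ℕ)) : ℝ) ^ (4 - (d + 1))) := by
    rw [show (1 : ℝ) = Real.sqrt 1 from Real.sqrt_one.symm]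
    refine Real.sqrt_lt_sqrt zero_le_one ?_
    calc (1 : ℝ) < 2 := one_lt_two
      _ ≤ ((ℓ + 1 : ℕ) : ℝ) := hL2
      _ = (((ℓ + 1 : ℕ)) : ℝ) ^ 1 := (pow_one _).symm
      _ ≤ (((ℓ + 1 : ℕ)) : ℝ) ^ (4 - (d + 1)) := pow_le_pow_right₀ (by linarith) (by omega)
  have hγ0 : 0 < Real.sqrt ((((ℓ + 1 : ℕ)) : ℝ) ^ (4 - (d + 1))) - 1 := by linarith
  have hKpos : 0 < (((4 * (16 * (d + 1)) * (ℓ + 1) ^ (d + 1) : ℕ)) : ℝ) *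
      (1 + Real.sqrt 2 * (((ℓ + 1 : ℕ)) : ℝ) ^ 2 / (Real.sqrt ((((ℓ + 1 : ℕ)) : ℝ) ^ (4 - (d + 1))) - 1)) /
        (8 * (((d + 1 : ℕ)) : ℝ)) + 2 * Real.sqrt 2 := by positivity
  refine ⟨1 / (100 * (((d + 1 : ℕ)) : ℝ)), ((((4 * (16 * (d + 1)) * (ℓ + 1) ^ (d + 1) : ℕ)) : ℝ) *
      (1 + Real.sqrt 2 * (((ℓ + 1 : ℕ)) : ℝ) ^ 2 / (Real.sqrt ((((ℓ + 1 : ℕ)) : ℝ) ^ (4 - (d + 1))) - 1)) /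
        (8 * (((d + 1 : ℕ)) : ℝ)) + 2 * Real.sqrt 2) ^ 2, by positivity, by positivity, ?_⟩
  intro P hPd hPL k hk Ω hΩ t ht0 ht1 ψ x hx hψ hflat hκ
  have hd3' : P.d ≤ 3 := by rw [hPd]; exact hd3
  have ht1' : t ≤ 1 / (100 * (P.d : ℝ)) := by rw [hPd]; exact ht1
  have h := tilted_col_sq_le_explicit P hd3' hk hΩ ht0 ht1' ψ hx hψ hflat hκ
  have e : ((((4 * (16 * P.d) * P.L ^ P.d : ℕ)) : ℝ) * (1 + Real.sqrt 2 * (P.L : ℝ) ^ 2 / (Real.sqrt ((P.L : ℝ) ^ (4 - P.d)) - 1)) /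
          (8 * (P.d : ℝ)) + 2 * Real.sqrt 2) ^ 2 / ((P.L : ℝ) ^ k) ^ P.d =
      ((((4 * (16 * (d + 1)) * (ℓ + 1) ^ (d + 1) : ℕ)) : ℝ) *
      (1 + Real.sqrt 2 * (((ℓ + 1 : ℕ)) : ℝ) ^ 2 / (Real.sqrt ((((ℓ + 1 : ℕ)) : ℝ) ^ (4 - (d + 1))) - 1)) /
        (8 * (((d + 1 : ℕ)) : ℝ)) + 2 * Real.sqrt 2) ^ 2 / ((P.L : ℝ) ^ k) ^ (d + 1) := by
    rw [hPd, hPL]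
  rw [e] at h
  exact h

end Main

end

end Literature.MathematicalPhysics.QuantumFieldTheory.BalabanImbrieJaffe1984to88.BIJ88FreeNeumannResolventRegionTiltedRow
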